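import Literature.MathematicalPhysics.KineticTheory.TaggedLinearBoltzmannSeries
import Literature.MathematicalPhysics.KineticTheory.TaggedSphereDiffusionProofs
import Literature.MathematicalPhysics.KineticTheory.LinearLorentzBoltzmannDuality
import Literature.MathematicalPhysics.KineticTheory.HardSphereEulerProofs
import HarnessLib

/-!
# The Carleman representation of the hard-sphere linear Boltzmann operator
(towards BGSR Lemma 6.1: Bodineau–Gallagher–Saint-Raymond, Invent. Math. 203 (2016),
arXiv:1305.3397v2 §6.1.2, after Hilbert 1912)

BGSR's Lemma 6.1 states that the linear Boltzmann operator `L` of (1.3) (a tagged sphere in a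
gas of like spheres at equilibrium `M_β`) is a Fredholm operator `L = a(v) - K` on
`L²(ℝ^d, a_β M_β dv)` with kernel the constants; it is the input for the corrector `b = L⁻¹ v`
of (6.5) (`Literature.MathematicalPhysics.KineticTheory.bgsr_exists_diffusionCorrector` in `TaggedSphereDiffusion`). The
classical proof (Hilbert [24], Grad, Cercignani–Illner–Pulvirenti 1994 §7.2) rests on
*Carleman's representation* of the gain term `K = K⁺_β` as an integral operator with an
explicit kernel, which this file establishes together with its elementary consequences.

## Main results

* `lintegral_gain_eq_carleman` (**Carleman representation**, pointwise in `v`): for `d ≥ 2`,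
  `β > 0` and measurable `F ≥ 0`,
  `∫∫ ((v - v₁)·ν)₊ M_β(v₁) F(v') dν dv₁ = ∫ k_β(v, u) F(v + u) du`, with the kernel
  `carlemanKernel β v u = |u|^{2-d} p_β(|u| + ⟪v, u⟫/|u|)`, `p_β` the centred Gaussian density
  of variance `β⁻¹` on `ℝ` (in the variables `v' = v + u`:
  `k(v, v') = |v' - v|^{2-d} p_β(⟪v', v' - v⟫/|v' - v|)`). Ingredients: under `M_β(v₁) dv₁`
  the coordinate `⟪v₁, ν⟫` is `N(0, β⁻¹)` (`map_inner_withDensity_maxwellianBeta`, from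
  `Kinetic.stdGaussian_eq_withDensity_globalMaxwellian` and `IsGaussian.map_eq_gaussianReal`),
  so the `dv₁`-integral only sees `r = (v - v₁)·ν` (`lintegral_gain_slice`); then `ν ↦ -ν`
  (`lintegral_sphere_neg`) and polar coordinates `u = r ν`
  (`Measure.measurePreserving_homeomorphUnitSphereProd`, `sphereMeasure = volume.toSphere`).
* Kernel algebra: `∫ k_β(v, u) du = a_β(v)` (`lintegral_carlemanKernel`); **detailed balance**
  `M_β(v) k_β(v, u) = M_β(v + u) k_β(v + u, -u)` (`maxwellianBeta_mul_carlemanKernel_symm`);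
  the two-sided bounds `(2π/β)^{(d-1)/2} |u|^{2-d} M_β(v + u) ≤ k_β(v, u)` (`carlemanKernel_ge`)
  and Grad's `M_β(v) k_β(v, u) ≤ (2π/β)^{-1/2} |u|^{2-d} e^{-β|u|²/8} √(M_β(v) M_β(v+u))`
  (`maxwellianBeta_mul_carlemanKernel_le`); the marginal identities
  `∫∫ M_β k_β G(v) = ∫ a_β M_β G = ∫∫ M_β k_β G(v + u)`
  (`lintegral_lintegral_maxwellianBeta_mul_carlemanKernel_left/right`).
* `L = a - K⁺` with `K⁺` in Carleman form: `linearBoltzmannGain β g v = ∫ k_β(v, u) g(v + u) du`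
  (`linearBoltzmannGain_eq_carlemanGain`) and
  `linearBoltzmannOp β g v = a_β(v) g(v) - linearBoltzmannGain β g v` (`linearBoltzmannOp_eq_sub`)
  whenever `u ↦ k_β(v, u) g(v + u)` is integrable, which holds for a.e. `v` as soon as
  `∫ g² a_β M_β < ∞` (`ae_integrable_carlemanKernel_mul`).
* The quadratic form `Q_β(g, h) = ∫∫ M_β(v) k_β(v, u) g(v + u) h(v) du dv = ⟨K⁺ g, h⟩_{L²(M_β)}`
  (`carlemanForm`) on functions of finite energy `∫ g² a_β M_β < ∞`: integrability, Fubini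
  (`carlemanForm_eq_integral_carlemanGain`), symmetry (`carlemanForm_comm`), Cauchy–Schwarz
  `Q_β(g, h)² ≤ ‖g‖² ‖h‖²` in `L²(a_β M_β)` (`sq_carlemanForm_le`), bilinearity.

All statements are in `EuclideanSpace ℝ d` with `2 ≤ Fintype.card d`, `0 < β`, next to the
objects of `TaggedSphereDiffusion` (`linearBoltzmannOp`, `collisionFrequency`) and
`TaggedLinearBoltzmannSeries` (`linearBoltzmannGain`, `gainIntegrand`).

## References

* T. Bodineau, I. Gallagher, L. Saint-Raymond, *The Brownian motion as the limit of a
  deterministic system of hard-spheres*, Invent. Math. 203 (2016) 493–553 = arXiv:1305.3397v2,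
  §6.1.2, Lemma 6.1.
* D. Hilbert, *Begründung der kinetischen Gastheorie*, Math. Ann. 72 (1912) 562–577 (BGSR [24]).
* C. Cercignani, R. Illner, M. Pulvirenti, *The Mathematical Theory of Dilute Gases*, Springer
  (1994), §7.2 (Carleman representation, Grad's estimates for hard spheres).
-/

open MeasureTheory Metric Set Filter Topology ProbabilityTheory
open scoped InnerProductSpace ENNReal NNReal

noncomputable section

namespace Literature.MathematicalPhysics.KineticTheory

variable {d : Type*} [Fintype d] {β : ℝ}

/-! ## The Maxwellian as a Gaussian measure; marginals along a direction -/

/-- **The Maxwellian is a scaled standard Gaussian**: `M_β(v) dv` is the image of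
`stdGaussian` under `w ↦ β^{-1/2} w`. [folklore] -/
theorem withDensity_maxwellianBeta_eq_map (hβ : 0 < β) :
    (volume : Measure (EuclideanSpace ℝ d)).withDensity
        (fun v => ENNReal.ofReal (Literature.Analysis.FunctionSpaces.maxwellianBeta β v)) =
      (stdGaussian (EuclideanSpace ℝ d)).map (fun w => Real.sqrt β⁻¹ • w) := by
  have hθ : 0 < β⁻¹ := inv_pos.2 hβ
  refine Measure.ext fun s hs => ?_
  have hmeas : Measurable fun w : EuclideanSpace ℝ d => Real.sqrt β⁻¹ • w :=
    measurable_const_smul _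
  rw [Measure.map_apply hmeas hs, withDensity_apply _ hs]
  -- both sides as Bochner integrals of indicators
  have h1 : ∫⁻ v in s, ENNReal.ofReal (Literature.Analysis.FunctionSpaces.maxwellianBeta β v) =
      ENNReal.ofReal (∫ v, Literature.Analysis.FunctionSpaces.maxwellianBeta β v • s.indicator (fun _ => (1 : ℝ)) v) := by
    rw [← ofReal_integral_eq_lintegral_ofReal
      ((KineticTheory.integrable_maxwellianBeta hβ).integrableOn)
      (Eventually.of_forall fun v => (Literature.Analysis.FunctionSpaces.maxwellianBeta_pos hβ v).le), ← integral_indicator hs]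
    congr 1
    refine integral_congr_ae (Eventually.of_forall fun v => ?_)
    by_cases hv : v ∈ s <;> simp [hv]
  have h2 : ∫ v, Literature.Analysis.FunctionSpaces.maxwellianBeta β v • s.indicator (fun _ => (1 : ℝ)) v =
      ∫ w, s.indicator (fun _ => (1 : ℝ)) ((0 : EuclideanSpace ℝ d) + Real.sqrt β⁻¹ • w)
        ∂stdGaussian (EuclideanSpace ℝ d) := by
    have := KineticTheory.integral_localMaxwellian_smul hθ (0 : EuclideanSpace ℝ d)
      (s.indicator fun _ => (1 : ℝ))
    simpa [Literature.Analysis.FunctionSpaces.maxwellianBeta] using this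
  rw [h1, h2]
  simp only [zero_add]
  rw [show (fun w : EuclideanSpace ℝ d => s.indicator (fun _ => (1 : ℝ)) (Real.sqrt β⁻¹ • w)) =
      ((fun w => Real.sqrt β⁻¹ • w) ⁻¹' s).indicator (fun _ => (1 : ℝ)) from by
    funext w
    exact (Set.indicator_comp_right (fun w : EuclideanSpace ℝ d => Real.sqrt β⁻¹ • w)).symm]
  rw [integral_indicator_const _ (hmeas hs), smul_eq_mul, mul_one, Measure.real,
    ENNReal.ofReal_toReal (measure_ne_top _ _)]

/-- **Gaussian marginals**: under `M_β(v) dv` the coordinate `⟪v, ν⟫` along a unit vector is a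
centred real Gaussian of variance `β⁻¹`. [folklore] -/
theorem map_inner_withDensity_maxwellianBeta (hβ : 0 < β) {ν : EuclideanSpace ℝ d} (hν : ‖ν‖ = 1) :
    ((volume : Measure (EuclideanSpace ℝ d)).withDensity
        (fun v => ENNReal.ofReal (Literature.Analysis.FunctionSpaces.maxwellianBeta β v))).map (fun v => ⟪v, ν⟫_ℝ) =
      gaussianReal 0 (β⁻¹).toNNReal := by
  have hθ : 0 < β⁻¹ := inv_pos.2 hβ
  set L : StrongDual ℝ (EuclideanSpace ℝ d) := Real.sqrt β⁻¹ • innerSL ℝ ν with hL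
  have hLapply : ∀ w, L w = ⟪Real.sqrt β⁻¹ • w, ν⟫_ℝ := fun w => by
    simp only [hL, _root_.smul_apply, innerSL_apply_apply, real_inner_smul_right, real_inner_comm,
      smul_eq_mul]
  rw [withDensity_maxwellianBeta_eq_map hβ, Measure.map_map (by fun_prop) (measurable_const_smul _)]
  have hcomp : (fun v : EuclideanSpace ℝ d => ⟪v, ν⟫_ℝ) ∘ (fun w => Real.sqrt β⁻¹ • w) = ⇑L := by
    funext w; simp [hLapply]
  have hnorm : ‖L‖ ^ 2 = β⁻¹ := by
    rw [hL, norm_smul, innerSL_apply_norm, hν, mul_one, Real.norm_eq_abs,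
      abs_of_nonneg (Real.sqrt_nonneg _), Real.sq_sqrt hθ.le]
  rw [hcomp, IsGaussian.map_eq_gaussianReal L, integral_strongDual_stdGaussian,
    variance_dual_stdGaussian, hnorm]

/-! ## Slicing the gain term along the impact direction -/

/-- **Gaussian marginal, `lintegral` form**: for measurable `Φ ≥ 0` and a unit vector `ν`,
`∫ M_β(v₁) Φ(⟪v₁, ν⟫) dv₁ = ∫ p_β(s) Φ(s) ds`, `p_β` the centred Gaussian density of variance
`β⁻¹`. [folklore] -/
theorem lintegral_maxwellianBeta_mul_comp_inner (hβ : 0 < β) {ν : EuclideanSpace ℝ d}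
    (hν : ‖ν‖ = 1) {Φ : ℝ → ℝ≥0∞} (hΦ : Measurable Φ) :
    ∫⁻ v₁, ENNReal.ofReal (Literature.Analysis.FunctionSpaces.maxwellianBeta β v₁) * Φ ⟪v₁, ν⟫_ℝ =
      ∫⁻ s, ENNReal.ofReal (gaussianPDFReal 0 (β⁻¹).toNNReal s) * Φ s := by
  have hM : Measurable fun v : EuclideanSpace ℝ d => ENNReal.ofReal (Literature.Analysis.FunctionSpaces.maxwellianBeta β v) :=
    (KineticTheory.measurable_maxwellianBeta β).ennreal_ofReal
  have hinner : Measurable fun v : EuclideanSpace ℝ d => ⟪v, ν⟫_ℝ :=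
    (continuous_id.inner continuous_const).measurable
  have hv : (β⁻¹).toNNReal ≠ 0 := by
    simpa [Real.toNNReal_eq_zero, not_le] using inv_pos.2 hβ
  calc ∫⁻ v₁, ENNReal.ofReal (Literature.Analysis.FunctionSpaces.maxwellianBeta β v₁) * Φ ⟪v₁, ν⟫_ℝ
      = ∫⁻ v₁, ((fun v : EuclideanSpace ℝ d => ENNReal.ofReal (Literature.Analysis.FunctionSpaces.maxwellianBeta β v)) *
          (Φ ∘ fun v => ⟪v, ν⟫_ℝ)) v₁ := rfl
    _ = ∫⁻ v₁, (Φ ∘ fun v => ⟪v, ν⟫_ℝ) v₁ ∂(volume : Measure (EuclideanSpace ℝ d)).withDensity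
          (fun v => ENNReal.ofReal (Literature.Analysis.FunctionSpaces.maxwellianBeta β v)) :=
        (lintegral_withDensity_eq_lintegral_mul _ hM (hΦ.comp hinner)).symm
    _ = ∫⁻ s, Φ s ∂((volume : Measure (EuclideanSpace ℝ d)).withDensity
          (fun v => ENNReal.ofReal (Literature.Analysis.FunctionSpaces.maxwellianBeta β v))).map (fun v => ⟪v, ν⟫_ℝ) :=
        (lintegral_map hΦ hinner).symm
    _ = ∫⁻ s, Φ s ∂gaussianReal 0 (β⁻¹).toNNReal := by
        rw [map_inner_withDensity_maxwellianBeta hβ hν]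
    _ = ∫⁻ s, (gaussianPDF 0 (β⁻¹).toNNReal * Φ) s := by
        rw [gaussianReal_of_var_ne_zero _ hv,
          lintegral_withDensity_eq_lintegral_mul _ (measurable_gaussianPDF _ _) hΦ]
    _ = ∫⁻ s, ENNReal.ofReal (gaussianPDFReal 0 (β⁻¹).toNNReal s) * Φ s := rfl

/-- **The gain term sliced along `ν`** (the one-dimensional reduction behind the Carleman
representation): for fixed `v` and impact direction `ν`, the `dv₁`-integral of
`((v - v₁)·ν)₊ M_β(v₁) F(v')` only sees the component of `v₁` along `ν`; with `v' = v - r ν`,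
`r = (v - v₁)·ν > 0`, it equals `∫_{r>0} r p_β(r - ⟪v, ν⟫) F(v - r ν) dr`. [folklore] -/
theorem lintegral_gain_slice (hβ : 0 < β) (ν : sphere (0 : EuclideanSpace ℝ d) 1)
    (v : EuclideanSpace ℝ d) {F : EuclideanSpace ℝ d → ℝ≥0∞} (hF : Measurable F) :
    ∫⁻ v₁, ENNReal.ofReal (hardSphereKernel (v, v₁) ν * Literature.Analysis.FunctionSpaces.maxwellianBeta β v₁) *
        F (collide ν (v, v₁)).1 =
      ∫⁻ r in Ioi (0 : ℝ), ENNReal.ofReal (r * gaussianPDFReal 0 (β⁻¹).toNNReal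
        (r - ⟪v, (ν : EuclideanSpace ℝ d)⟫_ℝ)) *
        F (v - r • (ν : EuclideanSpace ℝ d)) := by
  have hν : ‖(ν : EuclideanSpace ℝ d)‖ = 1 := norm_eq_of_mem_sphere ν
  set c : ℝ := ⟪v, (ν : EuclideanSpace ℝ d)⟫_ℝ with hc
  -- the integrand as `M(v₁) Φ(⟪v₁, ν⟫)`
  set Φ : ℝ → ℝ≥0∞ := fun s =>
    ENNReal.ofReal (max (c - s) 0) * F (v - (c - s) • (ν : EuclideanSpace ℝ d)) with hΦ
  have hΦm : Measurable Φ := by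
    refine Measurable.mul (by fun_prop) (hF.comp ?_)
    fun_prop
  have hpt : ∀ v₁ : EuclideanSpace ℝ d,
      ENNReal.ofReal (hardSphereKernel (v, v₁) ν * Literature.Analysis.FunctionSpaces.maxwellianBeta β v₁) *
          F (collide ν (v, v₁)).1 =
        ENNReal.ofReal (Literature.Analysis.FunctionSpaces.maxwellianBeta β v₁) * Φ ⟪v₁, (ν : EuclideanSpace ℝ d)⟫_ℝ := by
    intro v₁
    have hk : hardSphereKernel (v, v₁) ν = max (c - ⟪v₁, (ν : EuclideanSpace ℝ d)⟫_ℝ) 0 := by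
      simp [hardSphereKernel, hc, inner_sub_left]
    have hcol : (collide ν (v, v₁)).1 =
        v - (c - ⟪v₁, (ν : EuclideanSpace ℝ d)⟫_ℝ) • (ν : EuclideanSpace ℝ d) := by
      simp [collide, hc, inner_sub_left]
    rw [hk, hcol, hΦ]
    simp only
    rw [ENNReal.ofReal_mul (le_max_right _ _), mul_comm (ENNReal.ofReal (max _ _)), mul_assoc]
  simp_rw [hpt]
  rw [lintegral_maxwellianBeta_mul_comp_inner hβ hν hΦm]
  -- change of variable `s = c - r`
  rw [← lintegral_sub_left_eq_self _ c]
  simp only [hΦ, sub_sub_cancel]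
  -- restrict to `r > 0`
  rw [← setLIntegral_eq_of_support_subset (s := Ioi (0 : ℝ))]
  · refine setLIntegral_congr_fun measurableSet_Ioi (fun r hr => ?_)
    rw [max_eq_left (le_of_lt hr), ← mul_assoc, ← ENNReal.ofReal_mul (gaussianPDFReal_nonneg _ _ _),
      mul_comm (gaussianPDFReal _ _ _) r]
    congr 3
    simp only [gaussianPDFReal, sub_zero]
    congr 3
    ring
  · intro r hr
    rw [Function.mem_support] at hr
    by_contra h
    apply hr
    rw [max_eq_right (not_lt.1 h), ENNReal.ofReal_zero, zero_mul, mul_zero]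

/-! ## The Carleman representation -/

/-- **The Carleman kernel** of the hard-sphere gain term with Maxwellian bath at inverse
temperature `β`, in the variables `(v, u = v' - v)`:
`k_β(v, u) = |u|^{2-d} p_β(|u| + ⟪v, u⟫/|u|)`, `p_β` the centred Gaussian density of variance
`β⁻¹` on `ℝ` (so that `|u| + ⟪v, u⟫/|u| = ⟪v', v' - v⟫/|v' - v|`). Its value at `u = 0` is
irrelevant. [cite: BodineauGallagherSaintRaymondInvent2016, Lemma 6.1 (after Hilbert 1912)] -/
def carlemanKernel (β : ℝ) (v u : EuclideanSpace ℝ d) : ℝ :=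
  (‖u‖ ^ (Fintype.card d - 2))⁻¹ *
    gaussianPDFReal 0 (β⁻¹).toNNReal (‖u‖ + ⟪v, u⟫_ℝ / ‖u‖)

/-- The Carleman kernel is nonnegative. [folklore] -/
theorem carlemanKernel_nonneg (β : ℝ) (v u : EuclideanSpace ℝ d) : 0 ≤ carlemanKernel β v u :=
  mul_nonneg (inv_nonneg.2 (pow_nonneg (norm_nonneg _) _)) (gaussianPDFReal_nonneg _ _ _)

/-- Joint measurability of the Carleman kernel. [folklore] -/
theorem measurable_carlemanKernel (β : ℝ) :
    Measurable (Function.uncurry (carlemanKernel (d := d) β)) := by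
  have h1 : Measurable fun p : EuclideanSpace ℝ d × EuclideanSpace ℝ d => ‖p.2‖ :=
    measurable_snd.norm
  have h2 : Measurable fun p : EuclideanSpace ℝ d × EuclideanSpace ℝ d => ⟪p.1, p.2⟫_ℝ :=
    (continuous_fst.inner continuous_snd).measurable
  have h3 : Measurable fun p : EuclideanSpace ℝ d × EuclideanSpace ℝ d =>
      (‖p.2‖ ^ (Fintype.card d - 2))⁻¹ := (h1.pow_const _).inv
  have h4 : Measurable fun p : EuclideanSpace ℝ d × EuclideanSpace ℝ d =>
      gaussianPDFReal 0 (β⁻¹).toNNReal (‖p.2‖ + ⟪p.1, p.2⟫_ℝ / ‖p.2‖) :=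
    (measurable_gaussianPDFReal _ _).comp (h1.add (h2.div h1))
  exact h3.mul h4

/-- Measurability of the Carleman kernel in `u`. [folklore] -/
theorem measurable_carlemanKernel_right (β : ℝ) (v : EuclideanSpace ℝ d) :
    Measurable (carlemanKernel β v) :=
  (measurable_carlemanKernel β).of_uncurry_left

/-- The antipodal map preserves the surface measure: `∫ G(-ν) dν = ∫ G(ν) dν`. [folklore] -/
theorem lintegral_sphere_neg (G : sphere (0 : EuclideanSpace ℝ d) 1 → ℝ≥0∞) :
    ∫⁻ ν, G (-ν) ∂sphereMeasure = ∫⁻ ν, G ν ∂sphereMeasure := by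
  set A : EuclideanSpace ℝ d ≃ₗᵢ[ℝ] EuclideanSpace ℝ d := LinearIsometryEquiv.neg ℝ with hA
  set f₀ := (mapsTo_sphere_linearIsometryEquiv A).restrict A (sphere (0 : EuclideanSpace ℝ d) 1)
    (sphere (0 : EuclideanSpace ℝ d) 1) with hf₀
  have hf₀_apply : ∀ ν, f₀ ν = -ν := fun ν =>
    Subtype.ext (by simp [hf₀, MapsTo.val_restrict_apply, hA])
  have h := (measurePreserving_restrict_sphere A).lintegral_comp_emb
    (measurableEmbedding_restrict_sphere A) G
  simp_rw [← hf₀, hf₀_apply] at h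
  exact h

/-- The gain integrand `(v₁, ν) ↦ ((v - v₁)·ν)₊ M_β(v₁) F(v')` is jointly measurable.
[folklore] -/
theorem measurable_gainIntegrand_lintegral (β : ℝ) (v : EuclideanSpace ℝ d)
    {F : EuclideanSpace ℝ d → ℝ≥0∞} (hF : Measurable F) :
    Measurable fun p : EuclideanSpace ℝ d × sphere (0 : EuclideanSpace ℝ d) 1 =>
      ENNReal.ofReal (hardSphereKernel (v, p.1) p.2 * Literature.Analysis.FunctionSpaces.maxwellianBeta β p.1) *
        F (collide p.2 (v, p.1)).1 := by
  have h1 : Continuous fun p : EuclideanSpace ℝ d × sphere (0 : EuclideanSpace ℝ d) 1 =>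
      hardSphereKernel (v, p.1) p.2 :=
    continuous_hardSphereKernel.comp
      ((continuous_const.prodMk continuous_fst).prodMk continuous_snd)
  have h2 : Continuous fun p : EuclideanSpace ℝ d × sphere (0 : EuclideanSpace ℝ d) 1 =>
      (collide p.2 (v, p.1)).1 :=
    continuous_collide_fst.comp ((continuous_const.prodMk continuous_fst).prodMk continuous_snd)
  exact ((h1.mul ((KineticTheory.continuous_maxwellianBeta β).comp continuous_fst)).measurable
    |>.ennreal_ofReal).mul (hF.comp h2.measurable)

/-- **Carleman representation of the gain term** (pointwise in `v`, `lintegral` form): for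
`d ≥ 2`, `β > 0` and measurable `F ≥ 0`,
`∫∫ ((v - v₁)·ν)₊ M_β(v₁) F(v') dν dv₁ = ∫ k_β(v, u) F(v + u) du`.
The proof is the classical change of variables: slice `dv₁` along `ν` (Gaussian marginal,
`lintegral_gain_slice`), flip `ν ↦ -ν`, and pass to polar coordinates `u = r ν`
(`measurePreserving_homeomorphUnitSphereProd`, `sphereMeasure = volume.toSphere`).
[cite: BodineauGallagherSaintRaymondInvent2016, Lemma 6.1 (after Hilbert 1912)] -/
theorem lintegral_gain_eq_carleman (hd : 2 ≤ Fintype.card d) (hβ : 0 < β)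
    (v : EuclideanSpace ℝ d) {F : EuclideanSpace ℝ d → ℝ≥0∞} (hF : Measurable F) :
    ∫⁻ v₁, ∫⁻ ν, ENNReal.ofReal (hardSphereKernel (v, v₁) ν * Literature.Analysis.FunctionSpaces.maxwellianBeta β v₁) *
        F (collide ν (v, v₁)).1 ∂sphereMeasure =
      ∫⁻ u, ENNReal.ofReal (carlemanKernel β v u) * F (v + u) := by
  haveI : Nonempty d := Fintype.card_pos_iff.1 (by omega)
  have hdim : Module.finrank ℝ (EuclideanSpace ℝ d) = Fintype.card d := finrank_euclideanSpace
  set p : ℝ → ℝ := gaussianPDFReal 0 (β⁻¹).toNNReal with hp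
  -- Step 1: Tonelli
  rw [lintegral_lintegral_swap
    ((measurable_gainIntegrand_lintegral β v hF : Measurable (Function.uncurry fun v₁ ν =>
      ENNReal.ofReal (hardSphereKernel (v, v₁) ν * Literature.Analysis.FunctionSpaces.maxwellianBeta β v₁) *
        F (collide ν (v, v₁)).1)).aemeasurable)]
  -- Step 2: slice along `ν`
  have hslice : ∀ ν : sphere (0 : EuclideanSpace ℝ d) 1,
      ∫⁻ v₁, ENNReal.ofReal (hardSphereKernel (v, v₁) ν * Literature.Analysis.FunctionSpaces.maxwellianBeta β v₁) *
          F (collide ν (v, v₁)).1 =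
        ∫⁻ r in Ioi (0 : ℝ), ENNReal.ofReal (r * p (r - ⟪v, (ν : EuclideanSpace ℝ d)⟫_ℝ)) *
          F (v - r • (ν : EuclideanSpace ℝ d)) := fun ν => lintegral_gain_slice hβ ν v hF
  simp_rw [hslice]
  -- Step 3: `ν ↦ -ν`
  set G : sphere (0 : EuclideanSpace ℝ d) 1 → ℝ≥0∞ := fun ν =>
    ∫⁻ r in Ioi (0 : ℝ), ENNReal.ofReal (r * p (r + ⟪v, (ν : EuclideanSpace ℝ d)⟫_ℝ)) *
      F (v + r • (ν : EuclideanSpace ℝ d)) with hG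
  have hflip : ∀ ν : sphere (0 : EuclideanSpace ℝ d) 1,
      ∫⁻ r in Ioi (0 : ℝ), ENNReal.ofReal (r * p (r - ⟪v, (ν : EuclideanSpace ℝ d)⟫_ℝ)) *
          F (v - r • (ν : EuclideanSpace ℝ d)) = G (-ν) := fun ν => by
    simp only [hG, coe_neg_sphere, inner_neg_right, smul_neg, ← sub_eq_add_neg]
  simp_rw [hflip]
  rw [lintegral_sphere_neg G]
  -- Step 4: polar coordinates, starting from the right-hand side
  symm
  set H : EuclideanSpace ℝ d → ℝ≥0∞ := fun u => ENNReal.ofReal (carlemanKernel β v u) * F (v + u)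
    with hH
  have hHm : Measurable H :=
    ((measurable_carlemanKernel_right β v).ennreal_ofReal).mul (hF.comp (measurable_const_add v))
  set Gp : sphere (0 : EuclideanSpace ℝ d) 1 × Ioi (0 : ℝ) → ℝ≥0∞ := fun q =>
    H ((q.2 : ℝ) • (q.1 : EuclideanSpace ℝ d)) with hGp
  have hGpm : Measurable Gp :=
    hHm.comp ((continuous_subtype_val.comp continuous_snd).smul
      (continuous_subtype_val.comp continuous_fst)).measurable
  calc ∫⁻ u, H u = ∫⁻ u in ({0}ᶜ : Set (EuclideanSpace ℝ d)), H u := by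
        rw [restrict_compl_singleton]
    _ = ∫⁻ x : ({0}ᶜ : Set (EuclideanSpace ℝ d)), H x ∂(volume.comap Subtype.val) :=
        (lintegral_subtype_comap (measurableSet_singleton _).compl H).symm
    _ = ∫⁻ x : ({0}ᶜ : Set (EuclideanSpace ℝ d)),
          Gp (homeomorphUnitSphereProd (EuclideanSpace ℝ d) x)
          ∂(volume.comap Subtype.val) := by
        refine lintegral_congr fun x => ?_
        simp only [hGp, homeomorphUnitSphereProd_apply_snd_coe,
          homeomorphUnitSphereProd_apply_fst_coe]
        have hx : ‖(x : EuclideanSpace ℝ d)‖ ≠ 0 := by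
          rw [norm_ne_zero_iff]; exact x.2
        rw [smul_smul, mul_inv_cancel₀ hx, one_smul]
    _ = ∫⁻ q, Gp q ∂(sphereMeasure.prod (Measure.volumeIoiPow (Fintype.card d - 1))) := by
        have hmp :=
          (volume : Measure (EuclideanSpace ℝ d)).measurePreserving_homeomorphUnitSphereProd
        rw [hdim] at hmp
        exact hmp.lintegral_comp hGpm
    _ = ∫⁻ ν, ∫⁻ r, Gp (ν, r) ∂(Measure.volumeIoiPow (Fintype.card d - 1)) ∂sphereMeasure :=
        lintegral_prod _ hGpm.aemeasurable
    _ = ∫⁻ ν, G ν ∂sphereMeasure := by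
        refine lintegral_congr fun ν => ?_
        have hν : ‖(ν : EuclideanSpace ℝ d)‖ = 1 := norm_eq_of_mem_sphere ν
        have hm1 : Measurable fun r : Ioi (0 : ℝ) =>
            ENNReal.ofReal ((r : ℝ) ^ (Fintype.card d - 1)) :=
          (measurable_subtype_coe.pow_const _).ennreal_ofReal
        have hm2 : Measurable fun r : Ioi (0 : ℝ) => Gp (ν, r) :=
          hGpm.comp (measurable_const.prodMk measurable_id)
        have e1 : ∫⁻ r, Gp (ν, r) ∂(Measure.volumeIoiPow (Fintype.card d - 1)) =
            ∫⁻ r : Ioi (0 : ℝ), (fun s : ℝ => ENNReal.ofReal (s ^ (Fintype.card d - 1)) *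
              H (s • (ν : EuclideanSpace ℝ d))) (r : ℝ) ∂(volume.comap Subtype.val) :=
          lintegral_withDensity_eq_lintegral_mul _ hm1 hm2
        have e2 : ∫⁻ r : Ioi (0 : ℝ), (fun s : ℝ => ENNReal.ofReal (s ^ (Fintype.card d - 1)) *
              H (s • (ν : EuclideanSpace ℝ d))) (r : ℝ) ∂(volume.comap Subtype.val) =
            ∫⁻ s in Ioi (0 : ℝ), ENNReal.ofReal (s ^ (Fintype.card d - 1)) *
              H (s • (ν : EuclideanSpace ℝ d)) :=
          lintegral_subtype_comap (μ := (volume : Measure ℝ)) measurableSet_Ioi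
            (fun s : ℝ => ENNReal.ofReal (s ^ (Fintype.card d - 1)) *
              H (s • (ν : EuclideanSpace ℝ d)))
        rw [e1, e2, hG]
        refine setLIntegral_congr_fun measurableSet_Ioi fun r hr => ?_
        have hr' : (0 : ℝ) < r := hr
        simp only [hH, carlemanKernel, norm_smul, Real.norm_eq_abs, abs_of_pos hr', hν, mul_one,
          inner_smul_right]
        rw [← mul_assoc, ← ENNReal.ofReal_mul (pow_nonneg hr'.le _)]
        congr 2
        have hcr : r * ⟪v, (ν : EuclideanSpace ℝ d)⟫_ℝ / r = ⟪v, (ν : EuclideanSpace ℝ d)⟫_ℝ := by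
          field_simp
        rw [hcr, hp, ← mul_assoc]
        congr 1
        obtain ⟨k, hk⟩ := Nat.exists_eq_add_of_le hd
        rw [hk, show 2 + k - 1 = k + 1 by omega, show 2 + k - 2 = k by omega, pow_succ,
          mul_comm (r ^ k) r, mul_assoc, mul_inv_cancel₀ (pow_ne_zero _ hr'.ne'), mul_one]

/-! ## Algebra of the Carleman kernel -/

/-- The one-dimensional Gaussian density is even and decreasing in `|x|`. [folklore] -/
theorem gaussianPDFReal_zero_anti {x y : ℝ} (v : ℝ≥0) (h : |x| ≤ |y|) :
    gaussianPDFReal 0 v y ≤ gaussianPDFReal 0 v x := by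
  simp only [gaussianPDFReal, sub_zero]
  refine mul_le_mul_of_nonneg_left (Real.exp_le_exp.2 ?_) (inv_nonneg.2 (Real.sqrt_nonneg _))
  have hv : (0 : ℝ) ≤ 2 * v := by positivity
  have hsq : x ^ 2 ≤ y ^ 2 := by nlinarith [abs_nonneg x, sq_abs x, sq_abs y]
  rw [neg_div, neg_div, neg_le_neg_iff]
  exact div_le_div_of_nonneg_right hsq hv

/-- The one-dimensional Gaussian density is even. [folklore] -/
theorem gaussianPDFReal_zero_neg (v : ℝ≥0) (x : ℝ) :
    gaussianPDFReal 0 v (-x) = gaussianPDFReal 0 v x := by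
  simp [gaussianPDFReal]

/-- The radial Gaussian density in terms of the Maxwellian:
`p_β(|w|) = (2π/β)^{(d-1)/2} M_β(w)`. [folklore] -/
theorem gaussianPDFReal_norm_eq (hβ : 0 < β) (w : EuclideanSpace ℝ d) :
    gaussianPDFReal 0 (β⁻¹).toNNReal ‖w‖ =
      (2 * Real.pi * β⁻¹) ^ (((Fintype.card d : ℝ) - 1) / 2) * Literature.Analysis.FunctionSpaces.maxwellianBeta β w := by
  have hθ : 0 < β⁻¹ := inv_pos.2 hβ
  have h2π : 0 < 2 * Real.pi * β⁻¹ := by positivity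
  rw [KineticTheory.maxwellianBeta_eq, finrank_euclideanSpace]
  simp only [gaussianPDFReal, sub_zero, Real.coe_toNNReal _ hθ.le]
  rw [← mul_assoc]
  congr 1
  · rw [Real.sqrt_eq_rpow, ← Real.rpow_neg_one, ← Real.rpow_mul h2π.le, ← Real.rpow_add h2π]
    congr 1
    ring
  · congr 1
    field_simp

/-- **Lower bound**: `k_β(v, u) ≥ (2π/β)^{(d-1)/2} |u|^{2-d} M_β(v + u)`, because
`|⟪v + u, u⟫|/|u| ≤ |v + u|` and the Gaussian density decreases. [folklore] -/
theorem carlemanKernel_ge (hβ : 0 < β) (v u : EuclideanSpace ℝ d) :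
    (2 * Real.pi * β⁻¹) ^ (((Fintype.card d : ℝ) - 1) / 2) * (‖u‖ ^ (Fintype.card d - 2))⁻¹ *
        Literature.Analysis.FunctionSpaces.maxwellianBeta β (v + u) ≤ carlemanKernel β v u := by
  rw [carlemanKernel, mul_comm ((2 * Real.pi * β⁻¹) ^ _), mul_assoc, ← gaussianPDFReal_norm_eq hβ]
  refine mul_le_mul_of_nonneg_left (gaussianPDFReal_zero_anti _ ?_)
    (inv_nonneg.2 (pow_nonneg (norm_nonneg _) _))
  rw [abs_norm]
  by_cases hu : u = 0
  · simp [hu]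
  · have hnu : 0 < ‖u‖ := norm_pos_iff.2 hu
    have hid : ‖u‖ + ⟪v, u⟫_ℝ / ‖u‖ = ⟪v + u, u⟫_ℝ / ‖u‖ := by
      rw [inner_add_left, real_inner_self_eq_norm_sq]
      field_simp
      ring
    rw [hid, abs_div, abs_norm, div_le_iff₀ hnu]
    exact abs_real_inner_le_norm _ _

/-- **Detailed balance** for the Carleman kernel: the joint kernel `M_β(v) k_β(v, u)` is
symmetric under `(v, u) ↦ (v + u, -u)` (i.e. under `v ↔ v'`). [folklore] -/
theorem maxwellianBeta_mul_carlemanKernel_symm (hβ : 0 < β) (v u : EuclideanSpace ℝ d) :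
    Literature.Analysis.FunctionSpaces.maxwellianBeta β v * carlemanKernel β v u =
      Literature.Analysis.FunctionSpaces.maxwellianBeta β (v + u) * carlemanKernel β (v + u) (-u) := by
  have hθ : 0 < β⁻¹ := inv_pos.2 hβ
  by_cases hu : u = 0
  · simp [hu]
  have hnu : 0 < ‖u‖ := norm_pos_iff.2 hu
  simp only [carlemanKernel, norm_neg, inner_neg_right, KineticTheory.maxwellianBeta_eq, gaussianPDFReal,
    sub_zero, Real.coe_toNNReal _ hθ.le]
  -- reduce to the exponents
  have key : -(β / 2) * ‖v‖ ^ 2 + -(‖u‖ + ⟪v, u⟫_ℝ / ‖u‖) ^ 2 / (2 * β⁻¹) =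
      -(β / 2) * ‖v + u‖ ^ 2 + -(‖u‖ + -⟪v + u, u⟫_ℝ / ‖u‖) ^ 2 / (2 * β⁻¹) := by
    have h1 : ‖v + u‖ ^ 2 = ‖v‖ ^ 2 + 2 * ⟪v, u⟫_ℝ + ‖u‖ ^ 2 := norm_add_sq_real v u
    rw [inner_add_left, real_inner_self_eq_norm_sq, h1]
    field_simp
    ring
  calc (2 * Real.pi * β⁻¹) ^ (-(Module.finrank ℝ (EuclideanSpace ℝ d) : ℝ) / 2) *
        Real.exp (-(β / 2) * ‖v‖ ^ 2) *
        ((‖u‖ ^ (Fintype.card d - 2))⁻¹ * ((Real.sqrt (2 * Real.pi * β⁻¹))⁻¹ *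
          Real.exp (-(‖u‖ + ⟪v, u⟫_ℝ / ‖u‖) ^ 2 / (2 * β⁻¹))))
      = (2 * Real.pi * β⁻¹) ^ (-(Module.finrank ℝ (EuclideanSpace ℝ d) : ℝ) / 2) *
        (‖u‖ ^ (Fintype.card d - 2))⁻¹ * (Real.sqrt (2 * Real.pi * β⁻¹))⁻¹ *
        Real.exp (-(β / 2) * ‖v‖ ^ 2 + -(‖u‖ + ⟪v, u⟫_ℝ / ‖u‖) ^ 2 / (2 * β⁻¹)) := by
        rw [Real.exp_add]; ring
    _ = (2 * Real.pi * β⁻¹) ^ (-(Module.finrank ℝ (EuclideanSpace ℝ d) : ℝ) / 2) *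
        (‖u‖ ^ (Fintype.card d - 2))⁻¹ * (Real.sqrt (2 * Real.pi * β⁻¹))⁻¹ *
        Real.exp (-(β / 2) * ‖v + u‖ ^ 2 + -(‖u‖ + -⟪v + u, u⟫_ℝ / ‖u‖) ^ 2 / (2 * β⁻¹)) := by
        rw [key]
    _ = _ := by rw [Real.exp_add]; ring

/-- **Upper bound (Grad's estimate)**: `M_β(v) k_β(v, u) ≤ (2π/β)^{-1/2} |u|^{2-d} e^{-β|u|²/8}
√(M_β(v) M_β(v+u))`, from `|v|² + (c + r)² - (|v|² + |v + u|²)/2 = (c + r/2)² + r²/4` with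
`r = |u|`, `c = ⟪v, u⟫/|u|`. [folklore] -/
theorem maxwellianBeta_mul_carlemanKernel_le (hβ : 0 < β) (v u : EuclideanSpace ℝ d) :
    Literature.Analysis.FunctionSpaces.maxwellianBeta β v * carlemanKernel β v u ≤
      (Real.sqrt (2 * Real.pi * β⁻¹))⁻¹ * (‖u‖ ^ (Fintype.card d - 2))⁻¹ *
        Real.exp (-(β / 8) * ‖u‖ ^ 2) *
        Real.sqrt (Literature.Analysis.FunctionSpaces.maxwellianBeta β v * Literature.Analysis.FunctionSpaces.maxwellianBeta β (v + u)) := by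
  have hθ : 0 < β⁻¹ := inv_pos.2 hβ
  have h2π : 0 < 2 * Real.pi * β⁻¹ := by positivity
  set A : ℝ := (2 * Real.pi * β⁻¹) ^ (-(Module.finrank ℝ (EuclideanSpace ℝ d) : ℝ) / 2) with hA
  have hApos : 0 < A := Real.rpow_pos_of_pos h2π _
  set r : ℝ := ‖u‖ with hr
  set c : ℝ := ⟪v, u⟫_ℝ / r with hc
  have hrc : r * c = ⟪v, u⟫_ℝ := by
    by_cases hu : u = 0
    · simp [hr, hc, hu]
    · rw [hc, hr, mul_div_cancel₀ _ (norm_ne_zero_iff.2 hu)]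
  have hvu : ‖v + u‖ ^ 2 = ‖v‖ ^ 2 + 2 * (r * c) + r ^ 2 := by
    rw [hrc, hr]; exact norm_add_sq_real v u
  -- the square root of the product of Maxwellians
  have hsqrt : Real.sqrt (Literature.Analysis.FunctionSpaces.maxwellianBeta β v * Literature.Analysis.FunctionSpaces.maxwellianBeta β (v + u)) =
      A * Real.exp (-(β / 4) * (‖v‖ ^ 2 + ‖v + u‖ ^ 2)) := by
    rw [KineticTheory.maxwellianBeta_eq, KineticTheory.maxwellianBeta_eq, ← hA]
    have : A * Real.exp (-(β / 2) * ‖v‖ ^ 2) * (A * Real.exp (-(β / 2) * ‖v + u‖ ^ 2)) =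
        (A * Real.exp (-(β / 4) * (‖v‖ ^ 2 + ‖v + u‖ ^ 2))) ^ 2 := by
      rw [mul_pow, sq (Real.exp _), ← Real.exp_add,
        show -(β / 4) * (‖v‖ ^ 2 + ‖v + u‖ ^ 2) + -(β / 4) * (‖v‖ ^ 2 + ‖v + u‖ ^ 2) =
          -(β / 2) * ‖v‖ ^ 2 + -(β / 2) * ‖v + u‖ ^ 2 by ring, Real.exp_add]
      ring
    rw [this, Real.sqrt_sq (mul_nonneg hApos.le (Real.exp_nonneg _))]
  rw [hsqrt]
  simp only [carlemanKernel, KineticTheory.maxwellianBeta_eq, gaussianPDFReal, sub_zero,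
    Real.coe_toNNReal _ hθ.le, ← hA, ← hr, ← hc]
  -- compare exponents
  have hexp : Real.exp (-(β / 2) * ‖v‖ ^ 2) * Real.exp (-(r + c) ^ 2 / (2 * β⁻¹)) ≤
      Real.exp (-(β / 8) * r ^ 2) * Real.exp (-(β / 4) * (‖v‖ ^ 2 + ‖v + u‖ ^ 2)) := by
    rw [← Real.exp_add, ← Real.exp_add, Real.exp_le_exp, hvu]
    have : -(r + c) ^ 2 / (2 * β⁻¹) = -(β / 2) * (r + c) ^ 2 := by field_simp
    rw [this]
    nlinarith [sq_nonneg (c + r / 2), hβ]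
  have hnn : 0 ≤ A * ((r ^ (Fintype.card d - 2))⁻¹ * (Real.sqrt (2 * Real.pi * β⁻¹))⁻¹) :=
    mul_nonneg hApos.le (mul_nonneg (inv_nonneg.2 (pow_nonneg (norm_nonneg _) _))
      (inv_nonneg.2 (Real.sqrt_nonneg _)))
  calc A * Real.exp (-(β / 2) * ‖v‖ ^ 2) *
        ((r ^ (Fintype.card d - 2))⁻¹ * ((Real.sqrt (2 * Real.pi * β⁻¹))⁻¹ *
          Real.exp (-(r + c) ^ 2 / (2 * β⁻¹))))
      = A * ((r ^ (Fintype.card d - 2))⁻¹ * (Real.sqrt (2 * Real.pi * β⁻¹))⁻¹) *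
          (Real.exp (-(β / 2) * ‖v‖ ^ 2) * Real.exp (-(r + c) ^ 2 / (2 * β⁻¹))) := by ring
    _ ≤ A * ((r ^ (Fintype.card d - 2))⁻¹ * (Real.sqrt (2 * Real.pi * β⁻¹))⁻¹) *
          (Real.exp (-(β / 8) * r ^ 2) * Real.exp (-(β / 4) * (‖v‖ ^ 2 + ‖v + u‖ ^ 2))) :=
        mul_le_mul_of_nonneg_left hexp hnn
    _ = _ := by ring

/-! ## Marginals of the joint kernel `M_β(v) k_β(v, u)` -/

/-- **The Carleman kernel integrates to the collision frequency**: `∫ k_β(v, u) du = a_β(v)`.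
[folklore] -/
theorem lintegral_carlemanKernel (hd : 2 ≤ Fintype.card d) (hβ : 0 < β) (v : EuclideanSpace ℝ d) :
    ∫⁻ u, ENNReal.ofReal (carlemanKernel β v u) = ENNReal.ofReal (TaggedSphereDiffusion.collisionFrequency β v) := by
  have h := lintegral_gain_eq_carleman hd hβ v (F := fun _ => 1) measurable_const
  simp only [mul_one] at h
  rw [← h, collisionFrequency_eq]
  have hf : ∀ v₁ : EuclideanSpace ℝ d,
      ∫⁻ ν, ENNReal.ofReal (hardSphereKernel (v, v₁) ν * Literature.Analysis.FunctionSpaces.maxwellianBeta β v₁)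
        ∂sphereMeasure =
        ENNReal.ofReal (KineticTheory.lorentzLossRate (v - v₁) * Literature.Analysis.FunctionSpaces.maxwellianBeta β v₁) := by
    intro v₁
    rw [← integral_hardSphereKernel, ← integral_mul_const,
      ofReal_integral_eq_lintegral_ofReal]
    · have hi := integrable_gainIntegrand_sphere hβ (φ := fun _ => (1 : ℝ)) measurable_const
        (C := 1) (fun _ => by simp) v v₁
      simpa [gainIntegrand] using hi
    · exact Eventually.of_forall fun ν =>
        mul_nonneg (hardSphereKernel_nonneg _ _) (Literature.Analysis.FunctionSpaces.maxwellianBeta_pos hβ _).le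
  simp_rw [hf]
  rw [← ofReal_integral_eq_lintegral_ofReal (integrable_lorentzLossRate_mul_maxwellianBeta hβ v)
    (Eventually.of_forall fun w => mul_nonneg (KineticTheory.lorentzLossRate_nonneg _)
      (Literature.Analysis.FunctionSpaces.maxwellianBeta_pos hβ w).le)]

/-- Measurability of the joint kernel `(v, u) ↦ M_β(v) k_β(v, u)` (as an `ℝ≥0∞`-valued
function). [folklore] -/
theorem measurable_maxwellianBeta_mul_carlemanKernel (β : ℝ) :
    Measurable fun p : EuclideanSpace ℝ d × EuclideanSpace ℝ d =>
      ENNReal.ofReal (Literature.Analysis.FunctionSpaces.maxwellianBeta β p.1 * carlemanKernel β p.1 p.2) :=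
  (((KineticTheory.measurable_maxwellianBeta β).comp measurable_fst).mul
    (measurable_carlemanKernel β)).ennreal_ofReal

/-- **Loss-side marginal**: `∫∫ M_β(v) k_β(v, u) G(v) du dv = ∫ a_β(v) M_β(v) G(v) dv`.
[folklore] -/
theorem lintegral_lintegral_maxwellianBeta_mul_carlemanKernel_left (hd : 2 ≤ Fintype.card d)
    (hβ : 0 < β) (G : EuclideanSpace ℝ d → ℝ≥0∞) :
    ∫⁻ v, ∫⁻ u, ENNReal.ofReal (Literature.Analysis.FunctionSpaces.maxwellianBeta β v * carlemanKernel β v u) * G v =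
      ∫⁻ v, ENNReal.ofReal (TaggedSphereDiffusion.collisionFrequency β v * Literature.Analysis.FunctionSpaces.maxwellianBeta β v) * G v := by
  refine lintegral_congr fun v => ?_
  have hM := (Literature.Analysis.FunctionSpaces.maxwellianBeta_pos hβ v).le
  simp_rw [ENNReal.ofReal_mul hM]
  rw [lintegral_mul_const _ ((measurable_carlemanKernel_right β v).ennreal_ofReal.const_mul _),
    lintegral_const_mul _ (measurable_carlemanKernel_right β v).ennreal_ofReal,
    lintegral_carlemanKernel hd hβ v, ENNReal.ofReal_mul (TaggedLinearBoltzmannSeries.collisionFrequency_nonneg hβ v),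
    mul_comm (ENNReal.ofReal (TaggedSphereDiffusion.collisionFrequency β v))]

/-- The change of variables `(v, u) ↦ (v + u, -u)` (i.e. `v ↔ v'`) preserves `dv du`.
[folklore] -/
theorem measurePreserving_addNeg :
    MeasurePreserving (fun z : EuclideanSpace ℝ d × EuclideanSpace ℝ d => (z.1 + z.2, -z.2))
      ((volume : Measure (EuclideanSpace ℝ d)).prod volume)
      ((volume : Measure (EuclideanSpace ℝ d)).prod volume) := by
  have h1 := measurePreserving_add_prod_neg_right (volume : Measure (EuclideanSpace ℝ d))
    (volume : Measure (EuclideanSpace ℝ d))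
  have h2 : MeasurePreserving (Prod.swap : EuclideanSpace ℝ d × EuclideanSpace ℝ d →
      EuclideanSpace ℝ d × EuclideanSpace ℝ d) ((volume : Measure (EuclideanSpace ℝ d)).prod volume)
      ((volume : Measure (EuclideanSpace ℝ d)).prod volume) := Measure.measurePreserving_swap
  have h3 := h1.comp h2
  have hfun : ((fun z : EuclideanSpace ℝ d × EuclideanSpace ℝ d => (z.1 + z.2, -z.1)) ∘ Prod.swap) =
      fun z => (z.1 + z.2, -z.2) := by
    funext z; simp [add_comm]
  rw [hfun] at h3
  exact h3

/-- The shear `(v, u) ↦ (v, v + u)` preserves `dv du`. [folklore] -/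
theorem measurePreserving_prod_add_euclidean :
    MeasurePreserving (fun z : EuclideanSpace ℝ d × EuclideanSpace ℝ d => (z.1, z.1 + z.2))
      ((volume : Measure (EuclideanSpace ℝ d)).prod volume)
      ((volume : Measure (EuclideanSpace ℝ d)).prod volume) :=
  measurePreserving_prod_add _ _

/-- **Gain-side marginal** (detailed balance): `∫∫ M_β(v) k_β(v, u) G(v + u) du dv =
∫ a_β(w) M_β(w) G(w) dw`. [folklore] -/
theorem lintegral_lintegral_maxwellianBeta_mul_carlemanKernel_right (hd : 2 ≤ Fintype.card d)
    (hβ : 0 < β) {G : EuclideanSpace ℝ d → ℝ≥0∞} (hG : Measurable G) :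
    ∫⁻ v, ∫⁻ u, ENNReal.ofReal (Literature.Analysis.FunctionSpaces.maxwellianBeta β v * carlemanKernel β v u) * G (v + u) =
      ∫⁻ v, ENNReal.ofReal (TaggedSphereDiffusion.collisionFrequency β v * Literature.Analysis.FunctionSpaces.maxwellianBeta β v) * G v := by
  -- write as an integral on the product and change variables `(v, u) ↦ (v + u, -u)`
  set Φ : EuclideanSpace ℝ d × EuclideanSpace ℝ d → ℝ≥0∞ := fun z =>
    ENNReal.ofReal (Literature.Analysis.FunctionSpaces.maxwellianBeta β z.1 * carlemanKernel β z.1 z.2) * G z.1 with hΦ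
  have hΦm : Measurable Φ :=
    (measurable_maxwellianBeta_mul_carlemanKernel β).mul (hG.comp measurable_fst)
  have hpt : ∀ z : EuclideanSpace ℝ d × EuclideanSpace ℝ d,
      ENNReal.ofReal (Literature.Analysis.FunctionSpaces.maxwellianBeta β z.1 * carlemanKernel β z.1 z.2) * G (z.1 + z.2) =
        Φ (z.1 + z.2, -z.2) := fun z => by
    simp only [hΦ, maxwellianBeta_mul_carlemanKernel_symm hβ z.1 z.2]
  calc ∫⁻ v, ∫⁻ u, ENNReal.ofReal (Literature.Analysis.FunctionSpaces.maxwellianBeta β v * carlemanKernel β v u) * G (v + u)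
      = ∫⁻ z, ENNReal.ofReal (Literature.Analysis.FunctionSpaces.maxwellianBeta β z.1 * carlemanKernel β z.1 z.2) *
          G (z.1 + z.2) ∂((volume : Measure (EuclideanSpace ℝ d)).prod volume) :=
        (lintegral_prod (fun z : EuclideanSpace ℝ d × EuclideanSpace ℝ d =>
          ENNReal.ofReal (Literature.Analysis.FunctionSpaces.maxwellianBeta β z.1 * carlemanKernel β z.1 z.2) * G (z.1 + z.2))
          (((measurable_maxwellianBeta_mul_carlemanKernel β).mul
          (hG.comp measurable_add)).aemeasurable)).symm
    _ = ∫⁻ z, Φ (z.1 + z.2, -z.2) ∂((volume : Measure (EuclideanSpace ℝ d)).prod volume) := by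
        simp_rw [hpt]
    _ = ∫⁻ z, Φ z ∂((volume : Measure (EuclideanSpace ℝ d)).prod volume) :=
        measurePreserving_addNeg.lintegral_comp hΦm
    _ = ∫⁻ v, ∫⁻ u, Φ (v, u) := lintegral_prod _ hΦm.aemeasurable
    _ = _ := lintegral_lintegral_maxwellianBeta_mul_carlemanKernel_left hd hβ G

/-! ## The gain operator in Carleman form -/

/-- The gain operator in Carleman form, `(K_β g)(v) = ∫ k_β(v, u) g(v + u) du` (Bochner
integral; junk value `0` where `u ↦ k_β(v, u) g(v + u)` is not integrable).
[cite: BodineauGallagherSaintRaymondInvent2016, §6.1.2 (`L = a(v) - K`)] -/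
def carlemanGain (β : ℝ) (g : EuclideanSpace ℝ d → ℝ) (v : EuclideanSpace ℝ d) : ℝ :=
  ∫ u, carlemanKernel β v u * g (v + u)

/-- The enorm of the gain integrand. [folklore] -/
theorem enorm_gainIntegrand (hβ : 0 < β) (φ : EuclideanSpace ℝ d → ℝ) (v w : EuclideanSpace ℝ d)
    (ν : sphere (0 : EuclideanSpace ℝ d) 1) :
    ‖gainIntegrand β φ v w ν‖ₑ =
      ENNReal.ofReal (hardSphereKernel (v, w) ν * Literature.Analysis.FunctionSpaces.maxwellianBeta β w) *
        ‖φ (collide ν (v, w)).1‖ₑ := by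
  rw [gainIntegrand, enorm_mul, Real.enorm_of_nonneg
    (mul_nonneg (hardSphereKernel_nonneg _ _) (Literature.Analysis.FunctionSpaces.maxwellianBeta_pos hβ w).le)]

/-- **Tonelli for the gain term in Carleman variables**:
`∫∫ ((v - w)·ν)₊ M_β(w) |φ(v')| dν dw = ∫ k_β(v, u) |φ(v + u)| du` (as `lintegral`s).
[folklore] -/
theorem lintegral_lintegral_enorm_gainIntegrand (hd : 2 ≤ Fintype.card d) (hβ : 0 < β)
    {φ : EuclideanSpace ℝ d → ℝ} (hφ : Measurable φ) (v : EuclideanSpace ℝ d) :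
    ∫⁻ w, ∫⁻ ν, ‖gainIntegrand β φ v w ν‖ₑ ∂sphereMeasure =
      ∫⁻ u, ‖carlemanKernel β v u * φ (v + u)‖ₑ := by
  simp_rw [enorm_gainIntegrand hβ]
  rw [lintegral_gain_eq_carleman hd hβ v hφ.enorm]
  refine lintegral_congr fun u => ?_
  rw [enorm_mul, Real.enorm_of_nonneg (carlemanKernel_nonneg β v u)]

/-- The inner sphere `lintegral` of the gain integrand is measurable in `w`. [folklore] -/
theorem measurable_lintegral_enorm_gainIntegrand (β : ℝ) {φ : EuclideanSpace ℝ d → ℝ}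
    (hφ : Measurable φ) (v : EuclideanSpace ℝ d) :
    Measurable fun w => ∫⁻ ν, ‖gainIntegrand β φ v w ν‖ₑ ∂(sphereMeasure : Measure
      (sphere (0 : EuclideanSpace ℝ d) 1)) :=
  (measurable_gainIntegrand hφ v).enorm.lintegral_prod_right'

/-- For a nonnegative `φ`, the inner sphere integral of the gain integrand is the `toReal` of the
corresponding `lintegral`. [folklore] -/
theorem integral_gainIntegrand_eq_toReal (hβ : 0 < β) {φ : EuclideanSpace ℝ d → ℝ}
    (hφ : Measurable φ) (hφ0 : ∀ w, 0 ≤ φ w) (v w : EuclideanSpace ℝ d) :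
    ∫ ν, gainIntegrand β φ v w ν ∂sphereMeasure =
      (∫⁻ ν, ‖gainIntegrand β φ v w ν‖ₑ ∂sphereMeasure).toReal := by
  have hnn : ∀ ν, 0 ≤ gainIntegrand β φ v w ν := fun ν =>
    mul_nonneg (mul_nonneg (hardSphereKernel_nonneg _ _) (Literature.Analysis.FunctionSpaces.maxwellianBeta_pos hβ w).le)
      (hφ0 _)
  rw [integral_eq_lintegral_of_nonneg_ae (Eventually.of_forall hnn)
    ((measurable_gainIntegrand hφ v).comp measurable_prodMk_left).aestronglyMeasurable]
  congr 1
  refine lintegral_congr fun ν => ?_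
  rw [Real.enorm_of_nonneg (hnn ν)]

/-- **Carleman form of the gain operator, nonnegative case.** [folklore] -/
theorem linearBoltzmannGain_eq_carlemanGain_of_nonneg (hd : 2 ≤ Fintype.card d) (hβ : 0 < β)
    {φ : EuclideanSpace ℝ d → ℝ} (hφ : Measurable φ) (hφ0 : ∀ w, 0 ≤ φ w) (v : EuclideanSpace ℝ d)
    (hint : Integrable fun u => carlemanKernel β v u * φ (v + u)) :
    linearBoltzmannGain β φ v = carlemanGain β φ v := by
  have htonelli := lintegral_lintegral_enorm_gainIntegrand hd hβ hφ v
  have hfin : ∫⁻ u, ‖carlemanKernel β v u * φ (v + u)‖ₑ < ∞ := hint.2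
  rw [linearBoltzmannGain_eq]
  simp_rw [integral_gainIntegrand_eq_toReal hβ hφ hφ0 v]
  rw [integral_toReal (measurable_lintegral_enorm_gainIntegrand β hφ v).aemeasurable]
  · rw [htonelli, carlemanGain, integral_eq_lintegral_of_nonneg_ae]
    · congr 1
      refine lintegral_congr fun u => ?_
      rw [Real.enorm_of_nonneg (mul_nonneg (carlemanKernel_nonneg β v u) (hφ0 _))]
    · exact Eventually.of_forall fun u => mul_nonneg (carlemanKernel_nonneg β v u) (hφ0 _)
    · exact hint.1
  · refine ae_lt_top (measurable_lintegral_enorm_gainIntegrand β hφ v) ?_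
    rw [htonelli]
    exact hfin.ne

/-- For a.e. `w` the sphere integrand `ν ↦ ((v - w)·ν)₊ M_β(w) φ(v')` is integrable, as soon as
`u ↦ k_β(v, u) φ(v + u)` is. [folklore] -/
theorem ae_integrable_gainIntegrand (hd : 2 ≤ Fintype.card d) (hβ : 0 < β)
    {φ : EuclideanSpace ℝ d → ℝ} (hφ : Measurable φ) (v : EuclideanSpace ℝ d)
    (hint : Integrable fun u => carlemanKernel β v u * φ (v + u)) :
    ∀ᵐ w : EuclideanSpace ℝ d, Integrable (fun ν => gainIntegrand β φ v w ν)
      (sphereMeasure : Measure (sphere (0 : EuclideanSpace ℝ d) 1)) := by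
  have hfin : ∫⁻ w, ∫⁻ ν, ‖gainIntegrand β φ v w ν‖ₑ ∂sphereMeasure < ∞ := by
    rw [lintegral_lintegral_enorm_gainIntegrand hd hβ hφ v]; exact hint.2
  filter_upwards [ae_lt_top (measurable_lintegral_enorm_gainIntegrand β hφ v) hfin.ne] with w hw
  exact ⟨((measurable_gainIntegrand hφ v).comp measurable_prodMk_left).aestronglyMeasurable, hw⟩

/-- The inner sphere integral of the gain integrand is integrable in `w`, as soon as
`u ↦ k_β(v, u) φ(v + u)` is. [folklore] -/
theorem integrable_integral_gainIntegrand_of_carleman (hd : 2 ≤ Fintype.card d) (hβ : 0 < β)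
    {φ : EuclideanSpace ℝ d → ℝ} (hφ : Measurable φ) (v : EuclideanSpace ℝ d)
    (hint : Integrable fun u => carlemanKernel β v u * φ (v + u)) :
    Integrable fun w => ∫ ν, gainIntegrand β φ v w ν ∂(sphereMeasure : Measure
      (sphere (0 : EuclideanSpace ℝ d) 1)) := by
  have hfin : ∫⁻ w, ∫⁻ ν, ‖gainIntegrand β φ v w ν‖ₑ ∂sphereMeasure < ∞ := by
    rw [lintegral_lintegral_enorm_gainIntegrand hd hβ hφ v]; exact hint.2
  refine ⟨aestronglyMeasurable_integral_gainIntegrand hφ v, ?_⟩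
  refine lt_of_le_of_lt (lintegral_mono fun w => ?_) hfin
  exact enorm_integral_le_lintegral_enorm _

/-- **Carleman form of the gain operator**: `(K⁺_β φ)(v) = ∫ k_β(v, u) φ(v + u) du` whenever the
right-hand side converges absolutely. [cite: BodineauGallagherSaintRaymondInvent2016, §6.1.2] -/
theorem linearBoltzmannGain_eq_carlemanGain (hd : 2 ≤ Fintype.card d) (hβ : 0 < β)
    {φ : EuclideanSpace ℝ d → ℝ} (hφ : Measurable φ) (v : EuclideanSpace ℝ d)
    (hint : Integrable fun u => carlemanKernel β v u * φ (v + u)) :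
    linearBoltzmannGain β φ v = carlemanGain β φ v := by
  -- positive and negative parts
  set φp : EuclideanSpace ℝ d → ℝ := fun w => max (φ w) 0 with hφp
  set φm : EuclideanSpace ℝ d → ℝ := fun w => max (-φ w) 0 with hφm
  have hφpm : Measurable φp := hφ.max measurable_const
  have hφmm : Measurable φm := hφ.neg.max measurable_const
  have hφp0 : ∀ w, 0 ≤ φp w := fun w => le_max_right _ _
  have hφm0 : ∀ w, 0 ≤ φm w := fun w => le_max_right _ _
  have hdecomp : ∀ w, φ w = φp w - φm w := fun w => (max_zero_sub_max_neg_zero_eq_self (φ w)).symm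
  have hle_p : ∀ w, |φp w| ≤ |φ w| := fun w => by
    rw [abs_of_nonneg (hφp0 w)]; exact max_le (le_abs_self _) (abs_nonneg _)
  have hle_m : ∀ w, |φm w| ≤ |φ w| := fun w => by
    rw [abs_of_nonneg (hφm0 w)]; exact max_le (neg_le_abs _) (abs_nonneg _)
  have hintp : Integrable fun u => carlemanKernel β v u * φp (v + u) := by
    refine hint.norm.mono' ((measurable_carlemanKernel_right β v).mul
      (hφpm.comp (measurable_const_add v))).aestronglyMeasurable (Eventually.of_forall fun u => ?_)
    rw [Real.norm_eq_abs, Real.norm_eq_abs, abs_mul, abs_mul,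
      abs_of_nonneg (carlemanKernel_nonneg β v u)]
    exact mul_le_mul_of_nonneg_left (hle_p _) (carlemanKernel_nonneg β v u)
  have hintm : Integrable fun u => carlemanKernel β v u * φm (v + u) := by
    refine hint.norm.mono' ((measurable_carlemanKernel_right β v).mul
      (hφmm.comp (measurable_const_add v))).aestronglyMeasurable (Eventually.of_forall fun u => ?_)
    rw [Real.norm_eq_abs, Real.norm_eq_abs, abs_mul, abs_mul,
      abs_of_nonneg (carlemanKernel_nonneg β v u)]
    exact mul_le_mul_of_nonneg_left (hle_m _) (carlemanKernel_nonneg β v u)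
  have hp := linearBoltzmannGain_eq_carlemanGain_of_nonneg hd hβ hφpm hφp0 v hintp
  have hm := linearBoltzmannGain_eq_carlemanGain_of_nonneg hd hβ hφmm hφm0 v hintm
  -- the right-hand side splits
  have hR : carlemanGain β φ v = carlemanGain β φp v - carlemanGain β φm v := by
    rw [carlemanGain, carlemanGain, carlemanGain, ← integral_sub hintp hintm]
    refine integral_congr_ae (Eventually.of_forall fun u => ?_)
    simp only [hdecomp (v + u), mul_sub]
  -- the left-hand side splits (a.e. in `w`, then in the outer integral)
  have hL : linearBoltzmannGain β φ v =
      linearBoltzmannGain β φp v - linearBoltzmannGain β φm v := by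
    rw [linearBoltzmannGain_eq, linearBoltzmannGain_eq, linearBoltzmannGain_eq,
      ← integral_sub (integrable_integral_gainIntegrand_of_carleman hd hβ hφpm v hintp)
        (integrable_integral_gainIntegrand_of_carleman hd hβ hφmm v hintm)]
    refine integral_congr_ae ?_
    filter_upwards [ae_integrable_gainIntegrand hd hβ hφpm v hintp,
      ae_integrable_gainIntegrand hd hβ hφmm v hintm] with w hwp hwm
    rw [← integral_sub hwp hwm]
    refine integral_congr_ae (Eventually.of_forall fun ν => ?_)
    simp only [gainIntegrand, hdecomp ((collide ν (v, w)).1), mul_sub]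
  rw [hL, hR, hp, hm]

/-- **`L = a - K⁺`**: `(L φ)(v) = a_β(v) φ(v) - (K⁺_β φ)(v)` whenever `u ↦ k_β(v, u) φ(v + u)` is
integrable. [cite: BodineauGallagherSaintRaymondInvent2016, §6.1.2] -/
theorem linearBoltzmannOp_eq_sub (hd : 2 ≤ Fintype.card d) (hβ : 0 < β)
    {φ : EuclideanSpace ℝ d → ℝ} (hφ : Measurable φ) (v : EuclideanSpace ℝ d)
    (hint : Integrable fun u => carlemanKernel β v u * φ (v + u)) :
    linearBoltzmannOp β φ v = TaggedSphereDiffusion.collisionFrequency β v * φ v - linearBoltzmannGain β φ v := by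
  rw [linearBoltzmannOp, collisionFrequency_eq, linearBoltzmannGain_eq, mul_comm,
    ← integral_const_mul, ← integral_sub
      ((integrable_lorentzLossRate_mul_maxwellianBeta hβ v).const_mul _)
      (integrable_integral_gainIntegrand_of_carleman hd hβ hφ v hint)]
  refine integral_congr_ae ?_
  filter_upwards [ae_integrable_gainIntegrand hd hβ hφ v hint] with w hw
  have hloss : Integrable (fun ν => φ v * (hardSphereKernel (v, w) ν * Literature.Analysis.FunctionSpaces.maxwellianBeta β w))
      (sphereMeasure : Measure (sphere (0 : EuclideanSpace ℝ d) 1)) := by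
    have := integrable_gainIntegrand_sphere hβ (φ := fun _ => φ v) measurable_const (C := |φ v|)
      (fun _ => le_rfl) v w
    exact this.congr (Eventually.of_forall fun ν => by simp only [gainIntegrand]; ring)
  rw [← integral_hardSphereKernel, ← integral_mul_const, ← integral_const_mul,
    ← integral_sub hloss hw]
  refine integral_congr_ae (Eventually.of_forall fun ν => ?_)
  simp only [gainIntegrand]
  ring

/-! ## Absolute convergence for `g ∈ L²(a_β M_β)` -/

/-- The measure `a_β M_β dv` is finite. [folklore] -/
theorem lintegral_collisionFrequency_mul_maxwellianBeta_lt_top (hβ : 0 < β) :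
    ∫⁻ v : EuclideanSpace ℝ d,
      ENNReal.ofReal (TaggedSphereDiffusion.collisionFrequency β v * Literature.Analysis.FunctionSpaces.maxwellianBeta β v) < ∞ := by
  set S := KineticTheory.sphereMass (EuclideanSpace ℝ d) with hS
  set m₁ := KineticTheory.maxwellianMoment d β 1 with hm₁
  have hS0 : 0 ≤ S := KineticTheory.sphereMass_nonneg
  have hm₁0 : 0 ≤ m₁ := KineticTheory.maxwellianMoment_nonneg hβ 1
  have h0 := KineticTheory.integrable_maxwellianBeta (d := d) hβ
  have h1 := KineticTheory.integrable_pow_norm_mul_maxwellianBeta (d := d) hβ 1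
  simp only [pow_one] at h1
  have hint : Integrable fun v : EuclideanSpace ℝ d =>
      S * ((‖v‖ + m₁) * Literature.Analysis.FunctionSpaces.maxwellianBeta β v) := by
    have : (fun v : EuclideanSpace ℝ d => S * ((‖v‖ + m₁) * Literature.Analysis.FunctionSpaces.maxwellianBeta β v)) =
        fun v => S * (‖v‖ * Literature.Analysis.FunctionSpaces.maxwellianBeta β v) + S * m₁ * Literature.Analysis.FunctionSpaces.maxwellianBeta β v := by
      funext v; ring
    rw [this]
    exact (h1.const_mul S).add (h0.const_mul (S * m₁))
  refine lt_of_le_of_lt (lintegral_mono fun v => ?_) hint.2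
  have hM := (Literature.Analysis.FunctionSpaces.maxwellianBeta_pos hβ v).le
  rw [Real.enorm_of_nonneg (mul_nonneg hS0 (mul_nonneg (add_nonneg (norm_nonneg _) hm₁0) hM))]
  refine ENNReal.ofReal_le_ofReal ?_
  calc TaggedSphereDiffusion.collisionFrequency β v * Literature.Analysis.FunctionSpaces.maxwellianBeta β v
      ≤ S * (‖v‖ + m₁) * Literature.Analysis.FunctionSpaces.maxwellianBeta β v :=
        mul_le_mul_of_nonneg_right (collisionFrequency_le hβ v) hM
    _ = S * ((‖v‖ + m₁) * Literature.Analysis.FunctionSpaces.maxwellianBeta β v) := by ring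

/-! ## Functions of finite `a_β M_β`-energy: absolute convergence of `K⁺ g` -/

section Energy

variable {g h : EuclideanSpace ℝ d → ℝ}

/-- `|x| ≤ 1 + x²` in `ℝ≥0∞`. [folklore] -/
theorem enorm_le_one_add_ofReal_sq (x : ℝ) : ‖x‖ₑ ≤ 1 + ENNReal.ofReal (x ^ 2) := by
  rw [Real.enorm_eq_ofReal_abs, ← ENNReal.ofReal_one,
    ← ENNReal.ofReal_add zero_le_one (sq_nonneg _)]
  exact ENNReal.ofReal_le_ofReal (by nlinarith [abs_nonneg x, sq_abs x])

/-- The `lintegral` of `g² a_β M_β` is finite for `g` of finite energy. [folklore] -/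
theorem lintegral_energy_lt_top (hβ : 0 < β)
    (hg2 : Integrable fun v => g v ^ 2 * TaggedSphereDiffusion.collisionFrequency β v * Literature.Analysis.FunctionSpaces.maxwellianBeta β v) :
    ∫⁻ v, ENNReal.ofReal (TaggedSphereDiffusion.collisionFrequency β v * Literature.Analysis.FunctionSpaces.maxwellianBeta β v) *
      ENNReal.ofReal (g v ^ 2) < ∞ := by
  refine lt_of_le_of_lt (lintegral_mono fun v => ?_) hg2.2
  rw [← ENNReal.ofReal_mul (mul_nonneg (TaggedLinearBoltzmannSeries.collisionFrequency_nonneg hβ v)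
    (Literature.Analysis.FunctionSpaces.maxwellianBeta_pos hβ v).le), Real.enorm_of_nonneg (mul_nonneg (mul_nonneg
    (sq_nonneg _) (TaggedLinearBoltzmannSeries.collisionFrequency_nonneg hβ v)) (Literature.Analysis.FunctionSpaces.maxwellianBeta_pos hβ v).le)]
  exact ENNReal.ofReal_le_ofReal (le_of_eq (by ring))

/-- **Finite energy gives absolute convergence**:
`∫∫ M_β(v) k_β(v, u) |g(v + u)| du dv < ∞` if `∫ g² a_β M_β < ∞`. [folklore] -/
theorem lintegral_lintegral_maxwellianBeta_mul_carlemanKernel_mul_enorm_lt_top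
    (hd : 2 ≤ Fintype.card d) (hβ : 0 < β) (hg : Measurable g)
    (hg2 : Integrable fun v => g v ^ 2 * TaggedSphereDiffusion.collisionFrequency β v * Literature.Analysis.FunctionSpaces.maxwellianBeta β v) :
    ∫⁻ v, ∫⁻ u, ENNReal.ofReal (Literature.Analysis.FunctionSpaces.maxwellianBeta β v * carlemanKernel β v u) *
      ‖g (v + u)‖ₑ < ∞ := by
  have hK := measurable_maxwellianBeta_mul_carlemanKernel (d := d) β
  have hm1 : Measurable fun v : EuclideanSpace ℝ d => ∫⁻ u : EuclideanSpace ℝ d,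
      ENNReal.ofReal (Literature.Analysis.FunctionSpaces.maxwellianBeta β v * carlemanKernel β v u) * 1 :=
    Measurable.lintegral_prod_right' (f := fun p : EuclideanSpace ℝ d × EuclideanSpace ℝ d =>
      ENNReal.ofReal (Literature.Analysis.FunctionSpaces.maxwellianBeta β p.1 * carlemanKernel β p.1 p.2) * 1)
      (hK.mul measurable_const)
  have hm2 : ∀ v : EuclideanSpace ℝ d, Measurable fun u : EuclideanSpace ℝ d =>
      ENNReal.ofReal (Literature.Analysis.FunctionSpaces.maxwellianBeta β v * carlemanKernel β v u) * 1 := fun v =>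
    ((hK.comp measurable_prodMk_left).mul measurable_const)
  calc ∫⁻ v, ∫⁻ u, ENNReal.ofReal (Literature.Analysis.FunctionSpaces.maxwellianBeta β v * carlemanKernel β v u) * ‖g (v + u)‖ₑ
      ≤ ∫⁻ v, ∫⁻ u, (ENNReal.ofReal (Literature.Analysis.FunctionSpaces.maxwellianBeta β v * carlemanKernel β v u) * 1 +
          ENNReal.ofReal (Literature.Analysis.FunctionSpaces.maxwellianBeta β v * carlemanKernel β v u) *
            ENNReal.ofReal (g (v + u) ^ 2)) := by
        refine lintegral_mono fun v => lintegral_mono fun u => ?_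
        rw [← mul_add]
        exact mul_le_mul_right (enorm_le_one_add_ofReal_sq _) _
    _ = (∫⁻ v : EuclideanSpace ℝ d, ∫⁻ u : EuclideanSpace ℝ d,
          ENNReal.ofReal (Literature.Analysis.FunctionSpaces.maxwellianBeta β v * carlemanKernel β v u) * 1) +
          ∫⁻ v, ∫⁻ u, ENNReal.ofReal (Literature.Analysis.FunctionSpaces.maxwellianBeta β v * carlemanKernel β v u) *
            ENNReal.ofReal (g (v + u) ^ 2) := by
        rw [← lintegral_add_left hm1]
        exact lintegral_congr fun v => lintegral_add_left (hm2 v) _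
    _ < ∞ := by
        rw [lintegral_lintegral_maxwellianBeta_mul_carlemanKernel_left hd hβ,
          lintegral_lintegral_maxwellianBeta_mul_carlemanKernel_right hd hβ
            ((hg.pow_const 2).ennreal_ofReal)]
        simp only [mul_one]
        exact ENNReal.add_lt_top.2 ⟨lintegral_collisionFrequency_mul_maxwellianBeta_lt_top hβ,
          lintegral_energy_lt_top hβ hg2⟩

/-- **For a.e. `v`, `u ↦ k_β(v, u) g(v + u)` is integrable** when `g` has finite energy; at such
`v` the gain term converges absolutely and `L g = a g - K⁺ g`. [folklore] -/
theorem ae_integrable_carlemanKernel_mul (hd : 2 ≤ Fintype.card d) (hβ : 0 < β) (hg : Measurable g)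
    (hg2 : Integrable fun v => g v ^ 2 * TaggedSphereDiffusion.collisionFrequency β v * Literature.Analysis.FunctionSpaces.maxwellianBeta β v) :
    ∀ᵐ v : EuclideanSpace ℝ d, Integrable fun u => carlemanKernel β v u * g (v + u) := by
  have hK := measurable_maxwellianBeta_mul_carlemanKernel (d := d) β
  have hmeas : Measurable fun v => ∫⁻ u, ENNReal.ofReal (Literature.Analysis.FunctionSpaces.maxwellianBeta β v *
      carlemanKernel β v u) * ‖g (v + u)‖ₑ :=
    (hK.mul (hg.comp measurable_add).enorm).lintegral_prod_right'
  filter_upwards [ae_lt_top hmeas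
    (lintegral_lintegral_maxwellianBeta_mul_carlemanKernel_mul_enorm_lt_top hd hβ hg hg2).ne]
    with v hv
  have hM : ENNReal.ofReal (Literature.Analysis.FunctionSpaces.maxwellianBeta β v) ≠ 0 :=
    (ENNReal.ofReal_pos.2 (Literature.Analysis.FunctionSpaces.maxwellianBeta_pos hβ v)).ne'
  have hgv : Measurable fun u : EuclideanSpace ℝ d => g (v + u) := hg.comp (measurable_const_add v)
  have hkg : Measurable fun u => carlemanKernel β v u * g (v + u) :=
    (measurable_carlemanKernel_right β v).mul hgv
  refine ⟨hkg.aestronglyMeasurable, ?_⟩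
  have heq : ∫⁻ u, ENNReal.ofReal (Literature.Analysis.FunctionSpaces.maxwellianBeta β v * carlemanKernel β v u) *
      ‖g (v + u)‖ₑ =
      ENNReal.ofReal (Literature.Analysis.FunctionSpaces.maxwellianBeta β v) * ∫⁻ u, ‖carlemanKernel β v u * g (v + u)‖ₑ := by
    rw [← lintegral_const_mul _ hkg.enorm]
    refine lintegral_congr fun u => ?_
    rw [ENNReal.ofReal_mul (Literature.Analysis.FunctionSpaces.maxwellianBeta_pos hβ v).le, enorm_mul,
      Real.enorm_of_nonneg (carlemanKernel_nonneg β v u), mul_assoc]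
  rw [heq] at hv
  show ∫⁻ u, ‖carlemanKernel β v u * g (v + u)‖ₑ < ∞
  rcases ENNReal.mul_lt_top_iff.1 hv with h | h | h
  · exact h.2
  · exact absurd h hM
  · rw [h]; exact ENNReal.zero_lt_top

end Energy

/-! ## The quadratic forms of `K⁺` and `L` on `L²(a_β M_β)` in Carleman variables -/

section Forms

variable {g h : EuclideanSpace ℝ d → ℝ}

/-- The joint weight `M_β(v) k_β(v, u)` is nonnegative. [folklore] -/
theorem carlemanWeight_nonneg (hβ : 0 < β) (z : EuclideanSpace ℝ d × EuclideanSpace ℝ d) :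
    0 ≤ Literature.Analysis.FunctionSpaces.maxwellianBeta β z.1 * carlemanKernel β z.1 z.2 :=
  mul_nonneg (Literature.Analysis.FunctionSpaces.maxwellianBeta_pos hβ _).le (carlemanKernel_nonneg β _ _)

/-- The joint weight is measurable (real-valued). [folklore] -/
theorem measurable_carlemanWeight (β : ℝ) :
    Measurable fun z : EuclideanSpace ℝ d × EuclideanSpace ℝ d =>
      Literature.Analysis.FunctionSpaces.maxwellianBeta β z.1 * carlemanKernel β z.1 z.2 :=
  ((KineticTheory.measurable_maxwellianBeta β).comp measurable_fst).mul (measurable_carlemanKernel β)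

/-- The energy `∫ g² a_β M_β` as a `lintegral`. [folklore] -/
theorem ofReal_integral_energy (hβ : 0 < β)
    (hg2 : Integrable fun v => g v ^ 2 * TaggedSphereDiffusion.collisionFrequency β v * Literature.Analysis.FunctionSpaces.maxwellianBeta β v) :
    ENNReal.ofReal (∫ v, g v ^ 2 * TaggedSphereDiffusion.collisionFrequency β v * Literature.Analysis.FunctionSpaces.maxwellianBeta β v) =
      ∫⁻ v, ENNReal.ofReal (TaggedSphereDiffusion.collisionFrequency β v * Literature.Analysis.FunctionSpaces.maxwellianBeta β v) *
        ENNReal.ofReal (g v ^ 2) := by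
  rw [ofReal_integral_eq_lintegral_ofReal hg2 (Eventually.of_forall fun v =>
    mul_nonneg (mul_nonneg (sq_nonneg _) (TaggedLinearBoltzmannSeries.collisionFrequency_nonneg hβ v))
      (Literature.Analysis.FunctionSpaces.maxwellianBeta_pos hβ v).le)]
  refine lintegral_congr fun v => ?_
  rw [← ENNReal.ofReal_mul (mul_nonneg (TaggedLinearBoltzmannSeries.collisionFrequency_nonneg hβ v)
    (Literature.Analysis.FunctionSpaces.maxwellianBeta_pos hβ v).le)]
  congr 1; ring

/-- **Gain-side energy identity**: `∫∫ M_β(v) k_β(v, u) g(v + u)² du dv = ∫ g² a_β M_β`, with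
integrability on the product. [folklore] -/
theorem integrable_weight_mul_sq_shift (hd : 2 ≤ Fintype.card d) (hβ : 0 < β) (hg : Measurable g)
    (hg2 : Integrable fun v => g v ^ 2 * TaggedSphereDiffusion.collisionFrequency β v * Literature.Analysis.FunctionSpaces.maxwellianBeta β v) :
    Integrable (fun z : EuclideanSpace ℝ d × EuclideanSpace ℝ d =>
        Literature.Analysis.FunctionSpaces.maxwellianBeta β z.1 * carlemanKernel β z.1 z.2 * g (z.1 + z.2) ^ 2)
      ((volume : Measure (EuclideanSpace ℝ d)).prod volume) ∧
    ∫ z, Literature.Analysis.FunctionSpaces.maxwellianBeta β z.1 * carlemanKernel β z.1 z.2 * g (z.1 + z.2) ^ 2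
        ∂((volume : Measure (EuclideanSpace ℝ d)).prod volume) =
      ∫ v, g v ^ 2 * TaggedSphereDiffusion.collisionFrequency β v * Literature.Analysis.FunctionSpaces.maxwellianBeta β v := by
  have hmeas : Measurable fun z : EuclideanSpace ℝ d × EuclideanSpace ℝ d =>
      Literature.Analysis.FunctionSpaces.maxwellianBeta β z.1 * carlemanKernel β z.1 z.2 * g (z.1 + z.2) ^ 2 :=
    (measurable_carlemanWeight β).mul ((hg.comp measurable_add).pow_const 2)
  have hnn : ∀ z : EuclideanSpace ℝ d × EuclideanSpace ℝ d,
      0 ≤ Literature.Analysis.FunctionSpaces.maxwellianBeta β z.1 * carlemanKernel β z.1 z.2 * g (z.1 + z.2) ^ 2 := fun z =>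
    mul_nonneg (carlemanWeight_nonneg hβ z) (sq_nonneg _)
  have hlin : ∫⁻ z, ENNReal.ofReal (Literature.Analysis.FunctionSpaces.maxwellianBeta β z.1 * carlemanKernel β z.1 z.2 *
      g (z.1 + z.2) ^ 2) ∂((volume : Measure (EuclideanSpace ℝ d)).prod volume) =
      ∫⁻ v, ENNReal.ofReal (TaggedSphereDiffusion.collisionFrequency β v * Literature.Analysis.FunctionSpaces.maxwellianBeta β v) *
        ENNReal.ofReal (g v ^ 2) := by
    rw [← lintegral_lintegral_maxwellianBeta_mul_carlemanKernel_right hd hβ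
      ((hg.pow_const 2).ennreal_ofReal)]
    rw [lintegral_prod _ hmeas.ennreal_ofReal.aemeasurable]
    refine lintegral_congr fun v => lintegral_congr fun u => ?_
    rw [ENNReal.ofReal_mul (carlemanWeight_nonneg hβ (v, u))]
  have hfin : ∫⁻ z, ENNReal.ofReal (Literature.Analysis.FunctionSpaces.maxwellianBeta β z.1 * carlemanKernel β z.1 z.2 *
      g (z.1 + z.2) ^ 2) ∂((volume : Measure (EuclideanSpace ℝ d)).prod volume) < ∞ := by
    rw [hlin]; exact lintegral_energy_lt_top hβ hg2
  refine ⟨⟨hmeas.aestronglyMeasurable, ?_⟩, ?_⟩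
  · refine lt_of_le_of_lt (le_of_eq (lintegral_congr fun z => ?_)) hfin
    rw [Real.enorm_of_nonneg (hnn z)]
  · rw [integral_eq_lintegral_of_nonneg_ae (Eventually.of_forall hnn) hmeas.aestronglyMeasurable,
      hlin, ← ofReal_integral_energy hβ hg2, ENNReal.toReal_ofReal]
    exact integral_nonneg fun v => mul_nonneg (mul_nonneg (sq_nonneg _)
      (TaggedLinearBoltzmannSeries.collisionFrequency_nonneg hβ v)) (Literature.Analysis.FunctionSpaces.maxwellianBeta_pos hβ v).le

/-- **Loss-side energy identity**: `∫∫ M_β(v) k_β(v, u) h(v)² du dv = ∫ h² a_β M_β`, with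
integrability on the product. [folklore] -/
theorem integrable_weight_mul_sq (hd : 2 ≤ Fintype.card d) (hβ : 0 < β) (hh : Measurable h)
    (hh2 : Integrable fun v => h v ^ 2 * TaggedSphereDiffusion.collisionFrequency β v * Literature.Analysis.FunctionSpaces.maxwellianBeta β v) :
    Integrable (fun z : EuclideanSpace ℝ d × EuclideanSpace ℝ d =>
        Literature.Analysis.FunctionSpaces.maxwellianBeta β z.1 * carlemanKernel β z.1 z.2 * h z.1 ^ 2)
      ((volume : Measure (EuclideanSpace ℝ d)).prod volume) ∧
    ∫ z, Literature.Analysis.FunctionSpaces.maxwellianBeta β z.1 * carlemanKernel β z.1 z.2 * h z.1 ^ 2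
        ∂((volume : Measure (EuclideanSpace ℝ d)).prod volume) =
      ∫ v, h v ^ 2 * TaggedSphereDiffusion.collisionFrequency β v * Literature.Analysis.FunctionSpaces.maxwellianBeta β v := by
  have hmeas : Measurable fun z : EuclideanSpace ℝ d × EuclideanSpace ℝ d =>
      Literature.Analysis.FunctionSpaces.maxwellianBeta β z.1 * carlemanKernel β z.1 z.2 * h z.1 ^ 2 :=
    (measurable_carlemanWeight β).mul ((hh.comp measurable_fst).pow_const 2)
  have hnn : ∀ z : EuclideanSpace ℝ d × EuclideanSpace ℝ d,
      0 ≤ Literature.Analysis.FunctionSpaces.maxwellianBeta β z.1 * carlemanKernel β z.1 z.2 * h z.1 ^ 2 := fun z =>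
    mul_nonneg (carlemanWeight_nonneg hβ z) (sq_nonneg _)
  have hlin : ∫⁻ z, ENNReal.ofReal (Literature.Analysis.FunctionSpaces.maxwellianBeta β z.1 * carlemanKernel β z.1 z.2 *
      h z.1 ^ 2) ∂((volume : Measure (EuclideanSpace ℝ d)).prod volume) =
      ∫⁻ v, ENNReal.ofReal (TaggedSphereDiffusion.collisionFrequency β v * Literature.Analysis.FunctionSpaces.maxwellianBeta β v) *
        ENNReal.ofReal (h v ^ 2) := by
    rw [← lintegral_lintegral_maxwellianBeta_mul_carlemanKernel_left hd hβ
      (fun v => ENNReal.ofReal (h v ^ 2))]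
    rw [lintegral_prod _ hmeas.ennreal_ofReal.aemeasurable]
    refine lintegral_congr fun v => lintegral_congr fun u => ?_
    rw [ENNReal.ofReal_mul (carlemanWeight_nonneg hβ (v, u))]
  have hfin : ∫⁻ z, ENNReal.ofReal (Literature.Analysis.FunctionSpaces.maxwellianBeta β z.1 * carlemanKernel β z.1 z.2 *
      h z.1 ^ 2) ∂((volume : Measure (EuclideanSpace ℝ d)).prod volume) < ∞ := by
    rw [hlin]; exact lintegral_energy_lt_top hβ hh2
  refine ⟨⟨hmeas.aestronglyMeasurable, ?_⟩, ?_⟩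
  · refine lt_of_le_of_lt (le_of_eq (lintegral_congr fun z => ?_)) hfin
    rw [Real.enorm_of_nonneg (hnn z)]
  · rw [integral_eq_lintegral_of_nonneg_ae (Eventually.of_forall hnn) hmeas.aestronglyMeasurable,
      hlin, ← ofReal_integral_energy hβ hh2, ENNReal.toReal_ofReal]
    exact integral_nonneg fun v => mul_nonneg (mul_nonneg (sq_nonneg _)
      (TaggedLinearBoltzmannSeries.collisionFrequency_nonneg hβ v)) (Literature.Analysis.FunctionSpaces.maxwellianBeta_pos hβ v).le

/-- The mixed integrand `M_β(v) k_β(v, u) g(v + u) h(v)` is integrable on the product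
(`2|gh| ≤ g² + h²`). [folklore] -/
theorem integrable_weight_mul_mul (hd : 2 ≤ Fintype.card d) (hβ : 0 < β) (hg : Measurable g)
    (hg2 : Integrable fun v => g v ^ 2 * TaggedSphereDiffusion.collisionFrequency β v * Literature.Analysis.FunctionSpaces.maxwellianBeta β v)
    (hh : Measurable h)
    (hh2 : Integrable fun v => h v ^ 2 * TaggedSphereDiffusion.collisionFrequency β v * Literature.Analysis.FunctionSpaces.maxwellianBeta β v) :
    Integrable (fun z : EuclideanSpace ℝ d × EuclideanSpace ℝ d =>
        Literature.Analysis.FunctionSpaces.maxwellianBeta β z.1 * carlemanKernel β z.1 z.2 * (g (z.1 + z.2) * h z.1))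
      ((volume : Measure (EuclideanSpace ℝ d)).prod volume) := by
  have hA := (integrable_weight_mul_sq_shift hd hβ hg hg2).1
  have hB := (integrable_weight_mul_sq hd hβ hh hh2).1
  refine ((hA.add hB).div_const 2).mono' ((measurable_carlemanWeight β).mul
    ((hg.comp measurable_add).mul (hh.comp measurable_fst))).aestronglyMeasurable
    (Eventually.of_forall fun z => ?_)
  have hW := carlemanWeight_nonneg hβ z
  rw [Real.norm_eq_abs, abs_mul, abs_of_nonneg hW]
  simp only [Pi.add_apply]
  rw [le_div_iff₀ (two_pos), ← mul_add]
  have : |g (z.1 + z.2) * h z.1| * 2 ≤ g (z.1 + z.2) ^ 2 + h z.1 ^ 2 := by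
    rw [abs_mul]
    nlinarith [sq_nonneg (|g (z.1 + z.2)| - |h z.1|), sq_abs (g (z.1 + z.2)), sq_abs (h z.1),
      abs_nonneg (g (z.1 + z.2)), abs_nonneg (h z.1)]
  calc Literature.Analysis.FunctionSpaces.maxwellianBeta β z.1 * carlemanKernel β z.1 z.2 * |g (z.1 + z.2) * h z.1| * 2
      = Literature.Analysis.FunctionSpaces.maxwellianBeta β z.1 * carlemanKernel β z.1 z.2 *
          (|g (z.1 + z.2) * h z.1| * 2) := by
        ring
    _ ≤ _ := mul_le_mul_of_nonneg_left this hW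

/-- **The quadratic form of the gain operator** in Carleman variables:
`Q_β(g, h) = ∫∫ M_β(v) k_β(v, u) g(v + u) h(v) du dv` (`= ⟨K⁺ g, h⟩_{L²(M_β)}`).
[cite: BodineauGallagherSaintRaymondInvent2016, §6.1.2] -/
def carlemanForm (β : ℝ) (g h : EuclideanSpace ℝ d → ℝ) : ℝ :=
  ∫ z, Literature.Analysis.FunctionSpaces.maxwellianBeta β z.1 * carlemanKernel β z.1 z.2 * (g (z.1 + z.2) * h z.1)
    ∂((volume : Measure (EuclideanSpace ℝ d)).prod volume)

/-- **Cauchy–Schwarz**: `Q_β(g, h)² ≤ ‖g‖²_{a M} ‖h‖²_{a M}`. [folklore] -/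
theorem sq_carlemanForm_le (hd : 2 ≤ Fintype.card d) (hβ : 0 < β) (hg : Measurable g)
    (hg2 : Integrable fun v => g v ^ 2 * TaggedSphereDiffusion.collisionFrequency β v * Literature.Analysis.FunctionSpaces.maxwellianBeta β v)
    (hh : Measurable h)
    (hh2 : Integrable fun v => h v ^ 2 * TaggedSphereDiffusion.collisionFrequency β v * Literature.Analysis.FunctionSpaces.maxwellianBeta β v) :
    carlemanForm β g h ^ 2 ≤ (∫ v, g v ^ 2 * TaggedSphereDiffusion.collisionFrequency β v * Literature.Analysis.FunctionSpaces.maxwellianBeta β v) *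
      ∫ v, h v ^ 2 * TaggedSphereDiffusion.collisionFrequency β v * Literature.Analysis.FunctionSpaces.maxwellianBeta β v := by
  obtain ⟨hA, hAv⟩ := integrable_weight_mul_sq_shift hd hβ hg hg2
  obtain ⟨hB, hBv⟩ := integrable_weight_mul_sq hd hβ hh hh2
  rw [carlemanForm, ← hAv, ← hBv]
  exact sq_integral_weight_mul_le (carlemanWeight_nonneg hβ) hA hB
    (integrable_weight_mul_mul hd hβ hg hg2 hh hh2)

/-- The change of variables `(v, u) ↦ (v + u, -u)` as a measurable involution. [folklore] -/
def addNegEquiv :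
    EuclideanSpace ℝ d × EuclideanSpace ℝ d ≃ᵐ EuclideanSpace ℝ d × EuclideanSpace ℝ d where
  toFun z := (z.1 + z.2, -z.2)
  invFun z := (z.1 + z.2, -z.2)
  left_inv z := by simp
  right_inv z := by simp
  measurable_toFun := (measurable_fst.add measurable_snd).prodMk measurable_snd.neg
  measurable_invFun := (measurable_fst.add measurable_snd).prodMk measurable_snd.neg

/-- **Symmetry of the gain form** (detailed balance): `Q_β(g, h) = Q_β(h, g)`. [folklore] -/
theorem carlemanForm_comm (hβ : 0 < β) (g h : EuclideanSpace ℝ d → ℝ) :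
    carlemanForm β g h = carlemanForm β h g := by
  rw [carlemanForm, carlemanForm]
  have hmp : MeasurePreserving (addNegEquiv (d := d))
      ((volume : Measure (EuclideanSpace ℝ d)).prod volume)
      ((volume : Measure (EuclideanSpace ℝ d)).prod volume) := measurePreserving_addNeg
  rw [← hmp.integral_comp (addNegEquiv (d := d)).measurableEmbedding]
  refine integral_congr_ae (Eventually.of_forall fun z => ?_)
  show Literature.Analysis.FunctionSpaces.maxwellianBeta β (z.1 + z.2) * carlemanKernel β (z.1 + z.2) (-z.2) *
      (g (z.1 + z.2 + -z.2) * h (z.1 + z.2)) = _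
  rw [← maxwellianBeta_mul_carlemanKernel_symm hβ, add_neg_cancel_right, mul_comm (g z.1)]

/-- **Fubini for the gain form**: `Q_β(g, h) = ∫ (K⁺ g)(v) h(v) M_β(v) dv`. [folklore] -/
theorem carlemanForm_eq_integral_carlemanGain (hd : 2 ≤ Fintype.card d) (hβ : 0 < β)
    (hg : Measurable g)
    (hg2 : Integrable fun v => g v ^ 2 * TaggedSphereDiffusion.collisionFrequency β v * Literature.Analysis.FunctionSpaces.maxwellianBeta β v)
    (hh : Measurable h)
    (hh2 : Integrable fun v => h v ^ 2 * TaggedSphereDiffusion.collisionFrequency β v * Literature.Analysis.FunctionSpaces.maxwellianBeta β v) :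
    carlemanForm β g h = ∫ v, carlemanGain β g v * h v * Literature.Analysis.FunctionSpaces.maxwellianBeta β v := by
  rw [carlemanForm, integral_prod _ (integrable_weight_mul_mul hd hβ hg hg2 hh hh2)]
  refine integral_congr_ae (Eventually.of_forall fun v => ?_)
  simp only
  rw [carlemanGain, ← integral_mul_const, ← integral_mul_const]
  refine integral_congr_ae (Eventually.of_forall fun u => ?_)
  ring

/-- The gain form is additive in the first argument. [folklore] -/
theorem carlemanForm_add_left (hd : 2 ≤ Fintype.card d) (hβ : 0 < β)
    {g₁ g₂ : EuclideanSpace ℝ d → ℝ}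
    (hg₁ : Measurable g₁)
    (hg₁2 : Integrable fun v => g₁ v ^ 2 * TaggedSphereDiffusion.collisionFrequency β v * Literature.Analysis.FunctionSpaces.maxwellianBeta β v)
    (hg₂ : Measurable g₂)
    (hg₂2 : Integrable fun v => g₂ v ^ 2 * TaggedSphereDiffusion.collisionFrequency β v * Literature.Analysis.FunctionSpaces.maxwellianBeta β v)
    (hh : Measurable h)
    (hh2 : Integrable fun v => h v ^ 2 * TaggedSphereDiffusion.collisionFrequency β v * Literature.Analysis.FunctionSpaces.maxwellianBeta β v) :
    carlemanForm β (g₁ + g₂) h = carlemanForm β g₁ h + carlemanForm β g₂ h := by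
  rw [carlemanForm, carlemanForm, carlemanForm, ← integral_add
    (integrable_weight_mul_mul hd hβ hg₁ hg₁2 hh hh2)
    (integrable_weight_mul_mul hd hβ hg₂ hg₂2 hh hh2)]
  refine integral_congr_ae (Eventually.of_forall fun z => ?_)
  simp only [Pi.add_apply]
  ring

/-- The gain form is homogeneous in the first argument. [folklore] -/
theorem carlemanForm_smul_left (c : ℝ) (g h : EuclideanSpace ℝ d → ℝ) :
    carlemanForm β (c • g) h = c * carlemanForm β g h := by
  rw [carlemanForm, carlemanForm, ← integral_const_mul]
  refine integral_congr_ae (Eventually.of_forall fun z => ?_)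
  simp only [Pi.smul_apply, smul_eq_mul]
  ring

end Forms

end Literature.MathematicalPhysics.KineticTheory
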